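import Literature.Claims.NS.ClayVariants
import Literature.Analysis.FluidPDE.NSVorticityBKM
import Literature.Analysis.FluidPDE.NSVorticityBKMEnergy
import Literature.Analysis.FluidPDE.ClassicalSobolevUniqueness
import Literature.Analysis.FluidPDE.ClassicalNSHorizonPatching
import Literature.Analysis.FluidPDE.ClassicalSolutionRescale
import HarnessLib

/-!
# Claim skeleton (D-0090 NS-CLAIMS, C25): Ruzmaikina, arXiv:0810.0318v2 (2009) — a priori `L^∞` bounds on the
# vorticity and «global existence and uniqueness of strong solutions» of 3D Navier–Stokes

Typed skeleton of A. A. Ruzmaikina, *On boundedness, existence and uniqueness of strong solutions of the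
Navier-Stokes Equations in 3 dimensions*, arXiv:0810.0318 **v2** [math.GM], 3 Jan 2009, 25 pp. (text of record; v1
2 Oct 2008, 23 pp., has Theorems 1–4 verbatim identical and the same architecture; no journal version, no withdrawal),
bib `Ruzmaikina2008NSVorticityBounds`; TeX source, PDFs and per-page text held in
`run/shared/lean/pub/ns-claims/sources/Ruzmaikina2008/` (LOCATORS.md by ns-claims-lit-1). UNREFEREED CLAIM under
adjudication — NOTHING in this file asserts a step: the paper's statements are `def … : Prop`; the theorems are kernel
relations only (compositions, two elementary real-variable lemmas, the Clay link). Page numbers `p. N` are the v2 PDF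
pages (= printed pages); `(n)` are the PRINTED equation numbers (TeX labels in brackets where they exist).

SETTING (p. 1): Navier–Stokes on `ℝ³`, force `f ≡ 0`, fixed `ν > 0`, `|u| → 0` and `|ω| → 0` as `|x| → ∞`; the paper
works with the vorticity equation (2) for `ω = ∇ × u`, `|ω|_n` = `L^n(ℝ³)` norm, `ε = 1/100` fixed on p. 4
(`3.01 = 3 + ε`).

## The claimed statement (p. 2, verbatim)

"**Theorem 3:** Suppose that `|ω|_∞(0) < ∞`. Then for any `T > 0`, there exists a unique solution of the 3D Navier
Stokes Equations `ω(x,t)` for `x ∈ ℝ³` and `t ∈ [0, T]`, such that `|ω|_∞(t) < ∞` for `t ∈ [0, T]`." (restated on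
p. 22 with the bound `|ω|_∞(t) ≤ max(|ω|_∞(δ), e^e) < ∞`, `δ = ν/(2C|ω|_∞²(0))`, "`C` … independent of `ω`, `ν`,
etc."). "**Theorem 4:** Suppose that `|ω|₄(0) < ∞`. Then for any `T > 0`, there exists a unique solution … for
`t ∈ [0, T]`, such that `|ω|_∞(t) < ∞` for `t ∈ (0, T]`." Supporting: "**Theorem 1:** Suppose that `|ω|₂(t) < ∞`
for `t ∈ [t₁, t₂]` and also that `|ω|_∞(t₁) < ∞` and `|∇ω|_{3.01}(t₁) < ∞`. Then `|ω|_∞(t) < ∞` for `t ∈ [t₁,t₂]`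
and an upper bound (equation (43)) on `|ω|_∞(t)` can be given as a function of `t`, `max_{t∈[t₁,t₂]}|ω|₂(t)`,
`|ω|_∞(t₁)` and `|∇ω|_{3.01}(t₁)`." "**Theorem 2:** Suppose [the hypotheses of Theorem 1]. Suppose also that there
exists `n₀` such that for all `n > n₀`, either `|ω|_n(t) ≥ e^e` for all `t ∈ [t₁,t₂]` or `|ω|_n(t)` is a continuous
function of `t` for all `t ∈ [t₁,t₂]`. Then for all sufficiently large `n`,
`|ω|_n(t) ≤ max(e^{(1/n)e^{e^{t₂−t₁}}}|ω|_n(t₁), e^e)` and `|ω|_∞(t) ≤ max(|ω|_∞(t₁), e^e)` for `t ∈ [t₁,t₂]`."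

RENDERING (tree convention for «strong solutions», the one used for C17 `Chae2007` and the BKM files
`NSVorticity*.lean`): data = smooth divergence-free fields with every derivative in `L²(ℝ³)` (`IsDatum`; this
`H^∞ ∩ C^∞` class contains every Clay datum (4) and satisfies the printed hypotheses `|ω|_∞(0) < ∞`, `|ω|₄(0) < ∞`
and the standing decay assumptions); «solution on `[a,b]`» = classical unforced solution with all `L²` Sobolev norms
bounded on `[a,b]` (`IsSolutionOn`, the Beale–Kato–Majda class). In this class every norm the paper manipulates
(`|ω|_n` for `n ≥ 2`, `|ω|_∞`, `|∇ω|_{3.01}`, `|ω|₂`) is FINITE on `[a,b]` — so the `toReal` of the `ℝ≥0∞`-valued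
`eLpNorm`s below meets no junk value (TYPING-HYGIENE 1–3) — and `t ↦ |ω|_n(t)` is continuous (the continuity branch
of Theorem 2's dichotomy, `ImplicitContinuity`, classical). Theorems 3 and 4 render to the SAME Prop (`ClaimedTheorem`).
TODO(general form): data with only `|ω|_∞(0) < ∞` / `|ω|₄(0) < ∞` and the paper's (unspecified) strong-solution
class; every step below p. 17 is an a priori inequality read on the page, so the rendering does not move the locator.

## Clay delta (reference `Literature.Claims.NS.ClayVariants`)

Nearest Clay statement: (A). Δ1 domain `ℝ³` =; Δ3 force `f ≡ 0` =; Δ4 data: `|ω|_∞(0) < ∞` ⊋ Clay (4) — MORE data,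
stronger; Δ5 solution class: «unique solution with `|ω|_∞(t) < ∞`» (vorticity form; velocity by Biot–Savart implicit,
pressure/energy/`C^∞` not printed) — in the rendering (6) holds and the energy bound (7) follows from the tree's
`IsClassicalNSSolutionOn.bkm_energy_le`; Δ6 form of the conclusion: printed PER HORIZON «for any `T > 0` … on
`[0,T]`» with uniqueness — the patching of the unique solutions on the nested intervals `[0,T]` into ONE solution on
`[0,∞)` is classical bookkeeping, recorded as `ClayDelta` (not a «wrong problem» axis); `clay_of_claimed_of_delta`
PROVED. Δ7: every fixed `ν > 0` =. The paper's Theorem 2 bound `max(|ω|_∞(t₁), e^e)` is STRONGER than anything (A)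
needs (a universal cap with the dimensionful constant `e^e`).

## ORDERED STEP INDEX (dependency order = the order `claim_of_steps` consumes them; ties by print order)

* Step 1 = `Theorem1` (p. 2; proof Parts 1–5 pp. 2–17, output (43) [omegainftyupper] / (44) [omegainftyestN] p. 17–18
  together with (36) [omega3.01estimate] p. 15 and the sentence p. 4 "there exists `N > 0` such that `∫|ω|² (t) ≤ N`
  for `t ∈ [t₁,t₂]`"), typed IN THE FORM THE PROOF OF THEOREM 2 CONSUMES IT at (46)–(47) p. 19–20 ("Below we
  consider `n` satisfying `ln n > max_{t} K(t)` … in fact even larger `n`, because instead of `|ω|_∞(t)` we shall use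
  the estimate (44) and instead of `|∇ω|_{3+ε}^{3+ε}` we shall use (36)"): an enstrophy bound `N` and an admissible
  `n₀` with `K < ln n₀` on `[t₁,t₂]` exist. The printed inequality (43) itself is `Display43` (recorded, not consumed).
  Classical-type in the class (conditional regularity: bounded enstrophy ⇒ bounded higher norms).
* Step 2 = `Ineq45` (p. 18–19: (45) [eq1omn] and the three displays after it): `(1/n)∂ₜ∫|ω|ⁿ ≤ ∫|ω|ⁿ · K(t)`,
  `K(t) = 12.78|ω|_∞(t) ln(max(|ω|_∞(t),1)) + 1.1·10⁵|∇ω|_{3+ε}(t) + 2.07√N` (`kFun`).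
* Step 3 = `Ineq48` (p. 19–20: the logarithmic-derivative chain ending in "`∂ₜ ln ln ln ∫|ω|ⁿ ≤ K(t)/(ln|ω|_n(t)(ln n +
  ln ln|ω|_n(t)))`", the choice (46)/(47) `ln n > max K`, and (48) "`∂ₜ ln ln ln ∫|ω|ⁿ ≤ 1`"), SCALAR GRAIN (F15): for
  `X ≥ (e^e)ⁿ` with `X' ≤ nXK` and `K < ln n`, `(ln ln ln X)' ≤ 1`. True (calculus).
* Step 4 = `Ineq49` (p. 20, (49) "After integrating we obtain `ln ln ln ∫|ω|ⁿ(t) ≤ t − t₁ + ln ln ln ∫|ω|ⁿ(t₁)`"),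
  scalar grain. True (mean value); PROVED in v2 (`ineq49_holds`).
* Step 5 = `Inference50` (p. 21, (50) [TeX l. 372–375] "Therefore we obtain `∫|ω|ⁿ(x,t)d³x ≤ e^{e^{e^{t−t₁}}}
  ∫|ω|ⁿ(x,t₁)d³x` on `t ∈ [t₁,t₂]`" — the inference (49) ⇒ (50)), SCALAR GRAIN (F15) with every side condition in
  force at that line as a binder (`X(t₁) = aⁿ`, `X(t) = bⁿ`, `a, b ≥ e^e` — Part 1 hypothesis —, `s = t − t₁ ∈
  [0, t₂ − t₁]`, `n ≥ n₁` «sufficiently large», threshold depending on the horizon). The cell's PRE-REGISTERED LOCATOR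
  (CARD §4, STATUS `PREDICTED C25` 20:45:58Z; lit-1 LOCATORS §3 (i)): honest un-doing of (49) gives
  `X(t) ≤ exp((ln X(t₁))^{e^s})`, a tower, not the factor `e^{e^{e^s}}`; e.g. `s = 1`, `a = e^e`, `b = e^{e+1}`:
  (49) holds for every `n ≥ 1` while (50) reads `n(e+1) ≤ e^e + ne`, false for `n ≥ 16` — recorded here for the
  refuter/referee, NOT asserted. `Inference50Charitable` (threshold allowed to depend also on two-sided bounds for
  `a`, `b`) and `Inference50Pointwise` (the bare display) bracket it: `Pointwise → Inference50 → Charitable` (proved).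
* Step 6 = `Root51` (p. 21, (51) [omginftestimate] FIRST inequality: `|ω|_n(t) ≤ e^{(1/n)e^{e^{t−t₁}}}|ω|_n(t₁)`, the
  `n`-th root of (50)), scalar grain; PROVED (`root51_holds`). The SECOND inequality of (51) (`|ω|_n(t₁) ≤ |ω|_∞(t₁)`,
  also used at (58) p. 22 and as `|ω|₂(t) ≤ |ω|_∞(t)` at (60)–(61) pp. 22–23) is `NormComparison` — recorded, NOT
  consumed (the limit `n → ∞` needs only the first inequality); v2 adds its BARE SLICE FORM `NormComparisonSlice`
  (any datum's vorticity field; asked by ns-claims-ref-1 / ns-claims-refuter-2) with `normComparison_of_slice`.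
* Step 7 = `LimitN` (p. 21 "Taking `n → ∞` we obtain (52) `|ω|_∞(t) ≤ |ω|_∞(t₁)`" and p. 22 "Taking the limit
  `n → ∞` we obtain (59)"): in the class, an `n`-uniform family of bounds `|ω|_n(t) ≤ e^{(1/n)E} max(|ω|_n(t₁), c)`,
  `n ≥ n₂`, gives `|ω|_∞(t) ≤ max(|ω|_∞(t₁), c)`. True (`|ω|_n → |ω|_∞` for `ω ∈ L² ∩ L^∞`).
* Step 8 = `Part2` (Proof of Thm 2 Part 2, p. 21–22, (53)–(58): decomposition of `[t₁,t₂]` into the intervals where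
  `|ω|_n ≥ e^e`, (51) on each, ⇒ (58) `|ω|_n(t) ≤ e^{(1/n)e^{e^{t₂−t₁}}} max(|ω|_n(t₁), e^e)`), scalar grain over a
  continuous `f = |ω|_n(·)`. True (real analysis).
* Step 9 = `ImplicitContinuity` («implicit»: Theorem 2's dichotomy hypothesis p. 2, ASSUMED in the proofs of Theorems
  3–4 — p. 22 l. 12–14 of the proof "Also assume that for all `n` large enough … `|ω|_n(t)` is continuous as a function
  of `t`", p. 23 "Suppose also that there exists `n₀` … such that for all `n > n₀`, `|ω|_n(t)` is a continuous function
  of `t`" — and never discharged in print): in the class `t ↦ |ω|_n(t)` is continuous on `[t₁,t₂]`. True (classical).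
  Steps 1–9 compose to Theorem 2's conclusion (59) in the class: `theorem2_of_steps` (PROVED).
* Step 10 = `KuLocal` (p. 22, Proof of Thm 3: "by the Local Existence and Uniqueness Theorem (see Theorem 4.2 in [Ku],
  where we take `p = 2` and `M_{2p} = |ω|_∞(0)`) there exists `t₀ = ν/(2C|ω|_∞²(0))` such that for `t ∈ [0,t₀]` … there
  exists a unique solution … continuous and analytic"; [Ku] = I. Kukavica, IUMJ 48 (1999)), typed AS USED: a universal
  `C` and a local solution of length `ν/(2CM²)` from every slice of the class with `sup|ω| ≤ M`. (Flag for the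
  refuter: `ν/|ω|_∞²` has the dimension length² × time, not time; [Ku] Thm 4.2's own statement not re-read here.)
* Step 11 = `Iteration` (p. 22–23: "`t₀' = ν/(2C max(|ω|_∞²(δ), e^{2e}))` … Repeating this argument `k` times … For
  any `T > 0`, we can continue this argument up to `k ≥ T/t₀'`, to obtain that there exists a unique solution … on
  `[0,T]`" with (61)): local steps of uniform length + the a priori bound (59) at every restart ⇒ a solution on `[0,T]`.
  True (classical restart-and-glue bookkeeping; tree `IsClassicalNSSolutionOn.glue`).
* HEADLINE = `ClaimedTheorem` (Theorem 3 = Theorem 4 rendered). The blow-up-alternative paragraph of p. 22 (l. 1–11 of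
  the proof, display (60)) is not needed by the printed iteration and is not typed separately.

COMPOSITION: proved as `claim_of_steps : Step 1 → … → Step 11 → ClaimedTheorem` (existence by Steps 1–11; the
«unique» of Theorem 3, which the paper takes from [Ku], is the tree's discharged uniqueness theorem in the class,
`IsClassicalNSSolutionOn.eq_of_hasBoundedSobolevNormsOn`, Majda–Bertozzi Cor. 3.1). The paper's logic composes AS
PRINTED once (50) is granted; the pre-registered locator is Step 5 = (50) p. 21 (adjudicated by refuter/referee, not
here). v2 (append-only) also records `not_inference50_of_witness`: `¬ Inference50` follows from the two displayed real
inequalities at the `n`-uniform witness `s = 1`, `a = e^e`, `b = e^{e+1}`, `n ≥ 16` (kernel plumbing for the refuter;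
asserts nothing).

WHAT THIS IS NOT: not a claim about NS regularity or blow-up; not a claim about any author beyond the typed locator.
-/

noncomputable section

open Set Function Filter MeasureTheory
open scoped Topology ENNReal NNReal ContDiff

namespace Literature.Claims.NS.Ruzmaikina2008

open Literature.Analysis.FluidPDE

/-! ### Vocabulary of the paper (pp. 1–4, 18) over the tree's classical-solution / BKM-class predicates -/

/-- `|ω|_q(t)`: the `L^q(ℝ³)` norm of the vorticity `ω(·,t) = ∇ × u(·,t)` (p. 1; `q = n, 2, 4, ∞`), as a real number
(`toReal` of the `ℝ≥0∞`-valued `eLpNorm`; finite in the solution class below for `2 ≤ q ≤ ∞`).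
[cite: Ruzmaikina2008NSVorticityBounds, §1 p.1] -/
def vortNorm (q : ℝ≥0∞) (u : ℝ → EuclideanSpace ℝ (Fin 3) → EuclideanSpace ℝ (Fin 3)) (t : ℝ) : ℝ :=
  (eLpNorm (curl (u t)) q volume).toReal

/-- The exponent `3 + ε = 3.01` (`ε = 1/100` fixed on p. 4: "Below we assume that `ε = 1/100`").
[cite: Ruzmaikina2008NSVorticityBounds, p.4] -/
def pExp : ℝ≥0∞ := ENNReal.ofReal (301 / 100)

/-- `|∇ω|_q(t)`: the `L^q(ℝ³)` norm of the vorticity gradient (p. 2; the paper's pointwise `|∇ω|` is the Euclidean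
norm of the matrix, here the operator norm of the Fréchet derivative — equivalent up to an absolute constant), as a
real number. [cite: Ruzmaikina2008NSVorticityBounds, Theorem 1 p.2] -/
def gradVortNorm (q : ℝ≥0∞) (u : ℝ → EuclideanSpace ℝ (Fin 3) → EuclideanSpace ℝ (Fin 3)) (t : ℝ) : ℝ :=
  (eLpNorm (fun x => fderiv ℝ (curl (u t)) x) q volume).toReal

/-- The rate `K(t) = 12.78|ω|_∞(t) ln(max(|ω|_∞(t),1)) + 1.1·10⁵|∇ω|_{3+ε}(t) + 2.07√N` of the differential
inequality on p. 19 (second display: "`(1/n)∂ₜ∫|ω|ⁿ ≤ ∫|ω|ⁿ · (12.78|ω|_∞(t) ln(max(|ω|_∞(t),1)) + 1.1·10⁵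
|∇ω|_{3+ε}(t) + 2.07√N)`"), `N` the enstrophy bound of p. 4. [cite: Ruzmaikina2008NSVorticityBounds, p.19] -/
def kFun (N : ℝ) (u : ℝ → EuclideanSpace ℝ (Fin 3) → EuclideanSpace ℝ (Fin 3)) (t : ℝ) : ℝ :=
  12.78 * vortNorm ⊤ u t * Real.log (max (vortNorm ⊤ u t) 1) + 110000 * gradVortNorm pExp u t +
    2.07 * Real.sqrt N

/-- `ln ln ln x` (p. 19–21; for `x ≥ e^e` these are honest logarithms). [cite: Ruzmaikina2008NSVorticityBounds, (48)–(49) p.20] -/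
def lll (x : ℝ) : ℝ :=
  Real.log (Real.log (Real.log x))

/-- The DATA CLASS, rendered (p. 1–2: `|ω|_∞(0) < ∞` (Thm 3) / `|ω|₄(0) < ∞` (Thm 4), decay of `u` and `ω` at
infinity): smooth, divergence free, every derivative in `L²(ℝ³)` — the `H^∞ ∩ C^∞` class of the tree's BKM files (same
rendering as C17 `Chae2007.IsDatum`, restated to keep claim files independent); it contains all Clay data (4).
TODO(general form): the printed classes. [cite: Ruzmaikina2008NSVorticityBounds, Theorems 3–4 p.2] -/
def IsDatum (u₀ : EuclideanSpace ℝ (Fin 3) → EuclideanSpace ℝ (Fin 3)) : Prop :=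
  ContDiff ℝ ∞ u₀ ∧ VectorCalculus.IsDivFree u₀ ∧ ∀ n : ℕ, ∫⁻ x, ‖iteratedFDeriv ℝ n u₀ x‖ₑ ^ 2 < ⊤

/-- «Solution on `[a,b]`» (Theorems 1–2: "for `t ∈ [t₁,t₂]`"; Theorem 3: "on `[0,T]`"), rendered in the
Beale–Kato–Majda class of the tree (`NSVorticity.lean`): a classical unforced Navier–Stokes solution with viscosity `ν`
on `ℝ³ × [a,b]` with all `L²` Sobolev norms of `u` bounded on `[a,b]` (so the printed hypotheses `|ω|₂(t) < ∞` on
`[a,b]`, `|ω|_∞(a) < ∞`, `|∇ω|_{3.01}(a) < ∞` hold). [cite: Ruzmaikina2008NSVorticityBounds, Theorems 1–3 p.2] -/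
structure IsSolutionOn (ν a b : ℝ) (u : ℝ → EuclideanSpace ℝ (Fin 3) → EuclideanSpace ℝ (Fin 3))
    (p : ℝ → EuclideanSpace ℝ (Fin 3) → ℝ) : Prop where
  /-- the Navier–Stokes system (1) holds classically on `ℝ³ × [a,b]`, `u`, `p` jointly smooth, `f ≡ 0` -/
  isClassical : IsClassicalNSSolutionOn (Icc a b) ν 0 u p
  /-- all `L²` Sobolev norms of `u` are bounded on `[a,b]` («strong») -/
  sobolev : HasBoundedSobolevNormsOn (Icc a b) u

/-- «Solution on `[0,T]` of the initial value problem» (Theorem 3 p. 2): a solution on `[0,T]` with `u(0) = u₀`.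
[cite: Ruzmaikina2008NSVorticityBounds, Theorem 3 p.2] -/
structure IsSolution (ν T : ℝ) (u₀ : EuclideanSpace ℝ (Fin 3) → EuclideanSpace ℝ (Fin 3))
    (u : ℝ → EuclideanSpace ℝ (Fin 3) → EuclideanSpace ℝ (Fin 3)) (p : ℝ → EuclideanSpace ℝ (Fin 3) → ℝ) :
    Prop where
  /-- solution on `[0,T]` in the class -/
  sol : IsSolutionOn ν 0 T u p
  /-- initial condition -/
  initial : u 0 = u₀

/-- A global solution in the class (`[0,∞)`; the object Clay (A) asks for — used only in the Clay link).
[cite: FeffermanClay2006, statement (A)] -/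
structure IsGlobalSolution (ν : ℝ) (u₀ : EuclideanSpace ℝ (Fin 3) → EuclideanSpace ℝ (Fin 3))
    (u : ℝ → EuclideanSpace ℝ (Fin 3) → EuclideanSpace ℝ (Fin 3)) (p : ℝ → EuclideanSpace ℝ (Fin 3) → ℝ) :
    Prop where
  /-- classical on `ℝ³ × [0,∞)` -/
  isClassical : IsClassicalNSSolutionOn (Ici 0) ν 0 u p
  /-- initial condition -/
  initial : u 0 = u₀
  /-- all Sobolev norms bounded on every `[0,T]` -/
  sobolev : ∀ T : ℝ, HasBoundedSobolevNormsOn (Icc 0 T) u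

/-- Restriction of a solution to a closed sub-interval of positive length (plumbing). [folklore] -/
private theorem IsSolutionOn.mono {ν a b a' b' : ℝ} {u : ℝ → EuclideanSpace ℝ (Fin 3) → EuclideanSpace ℝ (Fin 3)}
    {p : ℝ → EuclideanSpace ℝ (Fin 3) → ℝ} (h : IsSolutionOn ν a b u p) (ha : a ≤ a') (hab : a' < b')
    (hb : b' ≤ b) : IsSolutionOn ν a' b' u p :=
  ⟨h.isClassical.mono (Icc_subset_Icc ha hb) (uniqueDiffOn_Icc hab), h.sobolev.mono (Icc_subset_Icc ha hb)⟩

/-! ### The claimed theorem (p. 2) -/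

/-- **HEADLINE — Theorem 3 (p. 2), as printed, in the rendered class**: "Suppose that `|ω|_∞(0) < ∞`. Then for any
`T > 0`, there exists a unique solution of the 3D Navier Stokes Equations `ω(x,t)` for `x ∈ ℝ³` and `t ∈ [0,T]`, such
that `|ω|_∞(t) < ∞` for `t ∈ [0,T]`." For every fixed `ν > 0` (p. 1) and every datum of the class: for every `T > 0`
a solution on `[0,T]` in the class exists, and any two such have the same velocity on `[0,T]` (`|ω|_∞(t) < ∞` holds
in the class). Theorem 4 (p. 2, data `|ω|₄(0) < ∞`, bound on `(0,T]`) renders to the same Prop.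
[claim: Ruzmaikina2008NSVorticityBounds, status: disputed] -/
def ClaimedTheorem : Prop :=
  ∀ ν : ℝ, 0 < ν → ∀ u₀ : EuclideanSpace ℝ (Fin 3) → EuclideanSpace ℝ (Fin 3), IsDatum u₀ → ∀ T : ℝ, 0 < T →
    (∃ (u : ℝ → EuclideanSpace ℝ (Fin 3) → EuclideanSpace ℝ (Fin 3)) (p : ℝ → EuclideanSpace ℝ (Fin 3) → ℝ),
      IsSolution ν T u₀ u p) ∧
    ∀ (u : ℝ → EuclideanSpace ℝ (Fin 3) → EuclideanSpace ℝ (Fin 3)) (p : ℝ → EuclideanSpace ℝ (Fin 3) → ℝ)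
      (u' : ℝ → EuclideanSpace ℝ (Fin 3) → EuclideanSpace ℝ (Fin 3)) (p' : ℝ → EuclideanSpace ℝ (Fin 3) → ℝ),
      IsSolution ν T u₀ u p → IsSolution ν T u₀ u' p' → ∀ t ∈ Icc 0 T, u' t = u t

/-- Theorem 2's conclusion (59) p. 22 ("`|ω|_∞(t) ≤ max(|ω|_∞(t₁), e^e)` for all `t ∈ [t₁,t₂]`"), in the class, at
viscosity `ν`, for every solution on every `[a,b]` — the a priori bound the iteration of Theorem 3 consumes ("By
Theorem 1, Theorem 2 and arguments above", p. 22–23). Not a hypothesis of `claim_of_steps`: it is DERIVED from Steps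
1–9 (`theorem2_of_steps`). [claim: Ruzmaikina2008NSVorticityBounds, status: disputed] -/
def AprioriBound59 (ν : ℝ) : Prop :=
  ∀ (a b : ℝ) (u : ℝ → EuclideanSpace ℝ (Fin 3) → EuclideanSpace ℝ (Fin 3)) (p : ℝ → EuclideanSpace ℝ (Fin 3) → ℝ),
    a < b → IsSolutionOn ν a b u p → ∀ t ∈ Icc a b, vortNorm ⊤ u t ≤ max (vortNorm ⊤ u a) (Real.exp (Real.exp 1))

/-- **Theorem 2 (p. 2) in the class, all `ν > 0`**: output (59) p. 22 for every solution on every interval (the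
dichotomy hypothesis holds in the class through its continuity branch, `ImplicitContinuity`).
[claim: Ruzmaikina2008NSVorticityBounds, status: disputed] -/
def Theorem2 : Prop :=
  ∀ ν : ℝ, 0 < ν → AprioriBound59 ν

/-! ### The paper's steps (no assertion) -/

/-- **Step 1 — Theorem 1 (p. 2; Parts 1–5, pp. 2–17; (43)/(44) p. 17–18 with (36) p. 15) in the form (46)–(47)
p. 19–20 consume it.** For a solution on `[t₁,t₂]` in the class: (p. 4) "there exists `N > 0` such that
`∫|ω(x)|²d³x (t) ≤ N` for `t ∈ [t₁,t₂]`", and — because (44) bounds `|ω|_∞(t)` and (36) bounds `∫|∇ω|^{3+ε}(t)` on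
`[t₁,t₂]` by data at `t₁`, `N`, `ν`, `t₂ − t₁` — the maximum of `K(t)` over `[t₁,t₂]` is finite and (47) exhibits an
admissible exponent: there is `n₀` with `K(t) < ln n₀` on `[t₁,t₂]` (we also record `n₀ ≥ 2`). The explicit (43) is
`Display43`. Classical-type (true in the class: Sobolev imbedding). [cite: Ruzmaikina2008NSVorticityBounds, Theorem 1 p.2, (43)–(44) p.17, (46)–(47) p.19–20] -/
def Theorem1 : Prop :=
  ∀ (ν t₁ t₂ : ℝ) (u : ℝ → EuclideanSpace ℝ (Fin 3) → EuclideanSpace ℝ (Fin 3))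
    (p : ℝ → EuclideanSpace ℝ (Fin 3) → ℝ), 0 < ν → t₁ < t₂ → IsSolutionOn ν t₁ t₂ u p →
    ∃ N : ℝ, 0 < N ∧ (∀ t ∈ Icc t₁ t₂, vortNorm 2 u t ^ 2 ≤ N) ∧
      ∃ n₀ : ℕ, 2 ≤ n₀ ∧ ∀ t ∈ Icc t₁ t₂, kFun N u t < Real.log n₀

/-- **Display (43)/(44), p. 17–18 (Theorem 1's bound, first line, verbatim shape)**: "`|ω|_∞(t₂) ≤ |ω|_∞(t₁)
exp(1.1·10⁵ (N²+1)(t₂−t₁) max_{t∈[t₁,t₂]}(|∇ω|^{3+ε}_{3+ε}(t) + 1))`", stated for every `t ∈ [t₁,t₂]` (apply (43)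
on `[t₁,t]`, = (44)) and for every upper bound `M₃` of the maximum. Recorded for the referee; NOT consumed by the
composition (its qualitative content is in `Theorem1`). [claim: Ruzmaikina2008NSVorticityBounds, status: disputed] -/
def Display43 : Prop :=
  ∀ (ν t₁ t₂ : ℝ) (u : ℝ → EuclideanSpace ℝ (Fin 3) → EuclideanSpace ℝ (Fin 3))
    (p : ℝ → EuclideanSpace ℝ (Fin 3) → ℝ), 0 < ν → t₁ < t₂ → IsSolutionOn ν t₁ t₂ u p → ∀ N M₃ : ℝ, 0 < N → 0 ≤ M₃ →
    (∀ t ∈ Icc t₁ t₂, vortNorm 2 u t ^ 2 ≤ N) →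
    (∀ t ∈ Icc t₁ t₂, gradVortNorm pExp u t ^ ((301 : ℝ) / 100) ≤ M₃) →
    ∀ t ∈ Icc t₁ t₂, vortNorm ⊤ u t ≤ vortNorm ⊤ u t₁ * Real.exp (110000 * (N ^ 2 + 1) * (t - t₁) * (M₃ + 1))

/-- **Step 2 — (45) [eq1omn] p. 18 and the displays of p. 19 up to "`∂ₜ ln ∫|ω|ⁿ ≤ n(…)`"**: "As in the derivation of
(38) [sic; the `L^n` identity of Part 5] we obtain (45) … Since we know from the Theorem 1 that `|ω|_∞(t) < ∞` for all
`t ∈ [t₁,t₂]`, we can estimate the right hand side of (45) as follows … `(1/n)∂ₜ∫|ω|ⁿ(x)d³x ≤ ∫|ω|ⁿ(x)d³x ·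
(12.78|ω|_∞(t) ln(max(|ω|_∞(t),1)) + 1.1·10⁵|∇ω|_{3+ε}(t) + 2.07√N)`" (near field `|y| ≤ min(|ω|_∞⁻¹,1)`, annulus up
to `|y| = 1`, far field; viscous term dropped). TYPED in the class for `n ≥ 2`: `t ↦ |ω|_n(t)ⁿ = ∫|ω|ⁿ` is
differentiable within `[t₁,t₂]` with derivative `≤ n ∫|ω|ⁿ K(t)`. (Plausible in shape — the Biot–Savart splitting is
the classical logarithmic estimate; the constants are the paper's.) [claim: Ruzmaikina2008NSVorticityBounds, status: disputed] -/
def Ineq45 : Prop :=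
  ∀ (ν t₁ t₂ : ℝ) (u : ℝ → EuclideanSpace ℝ (Fin 3) → EuclideanSpace ℝ (Fin 3))
    (p : ℝ → EuclideanSpace ℝ (Fin 3) → ℝ), 0 < ν → t₁ < t₂ → IsSolutionOn ν t₁ t₂ u p → ∀ N : ℝ, 0 < N →
    (∀ t ∈ Icc t₁ t₂, vortNorm 2 u t ^ 2 ≤ N) → ∀ n : ℕ, 2 ≤ n →
    ∀ t ∈ Icc t₁ t₂, ∃ D : ℝ, HasDerivWithinAt (fun s => vortNorm n u s ^ n) D (Icc t₁ t₂) t ∧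
      D ≤ (n : ℝ) * vortNorm n u t ^ n * kFun N u t

/-- **Step 3 — p. 19–20, the logarithmic-derivative chain, the choice (46)/(47) of `n` and (48)**, at the SCALAR GRAIN
(F15): "`∂ₜ ln ln ln ∫|ω|ⁿ ≤ K(t)/(ln|ω|_n(t)(ln n + ln ln|ω|_n(t)))` … Below we consider `n` satisfying (46)
`ln n > max_{t∈[t₁,t₂]} K(t)` … For `n` satisfying (47) we have that (48) `∂ₜ ln ln ln ∫|ω|ⁿ(x)d³x ≤ 1`." For a real
function `X ≥ (e^e)ⁿ` on `[a,b]` (Part 1: `|ω|_n ≥ e^e`, `X = |ω|_nⁿ`) with `X' ≤ nXK` and `K < ln n` there: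
`(ln ln ln X)' ≤ 1` on `[a,b]`. (True: `(ln ln ln X)' = X'/(X ln X ln ln X) ≤ nK/(n ln|ω|_n · ln n) < 1/e`.)
[claim: Ruzmaikina2008NSVorticityBounds, status: disputed] -/
def Ineq48 : Prop :=
  ∀ (n : ℕ) (a b : ℝ) (X K : ℝ → ℝ), 2 ≤ n → a < b →
    (∀ t ∈ Icc a b, Real.exp (Real.exp 1) ^ n ≤ X t) →
    (∀ t ∈ Icc a b, ∃ D : ℝ, HasDerivWithinAt X D (Icc a b) t ∧ D ≤ (n : ℝ) * X t * K t) →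
    (∀ t ∈ Icc a b, K t < Real.log n) →
    ∀ t ∈ Icc a b, ∃ D : ℝ, HasDerivWithinAt (fun s => lll (X s)) D (Icc a b) t ∧ D ≤ 1

/-- **Step 4 — (49) p. 20**: "After integrating we obtain (49) `ln ln ln ∫|ω|ⁿ(x,t)d³x ≤ t − t₁ + ln ln ln
∫|ω|ⁿ(x,t₁)d³x`", scalar grain: a function with derivative `≤ 1` within `[a,b]` grows at most with slope `1`. (True:
mean value theorem.) [claim: Ruzmaikina2008NSVorticityBounds, status: disputed] -/
def Ineq49 : Prop :=
  ∀ (a b : ℝ) (F : ℝ → ℝ), a < b →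
    (∀ t ∈ Icc a b, ∃ D : ℝ, HasDerivWithinAt F D (Icc a b) t ∧ D ≤ 1) →
    ∀ t ∈ Icc a b, F t ≤ (t - a) + F a

/-- **Step 5 — (50) p. 21 (TeX l. 372–375), the inference (49) ⇒ (50), SCALAR GRAIN (F15) — the cell's pre-registered
locator.** Print: "[(49)] `ln ln ln ∫|ω|ⁿ(x,t)d³x ≤ t − t₁ + ln ln ln ∫|ω|ⁿ(x,t₁)d³x`. Therefore we obtain (50)
`∫|ω|ⁿ(x,t)d³x ≤ e^{e^{e^{t−t₁}}} ∫|ω|ⁿ(x,t₁)d³x` on `t ∈ [t₁,t₂]`." TYPED with every side condition in force at that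
line as a binder: `X(t₁) = aⁿ`, `X(t) = bⁿ` with `a = |ω|_n(t₁) ≥ e^e`, `b = |ω|_n(t) ≥ e^e` (Part 1 hypothesis, p. 18),
`s = t − t₁ ∈ [0, τ]`, `τ = t₂ − t₁ > 0`, and `n ≥ n₁` «sufficiently large» with the threshold allowed to depend on the
horizon `τ` ((47) fixes `n` from the data of the interval): for all such, `ln ln ln(bⁿ) ≤ s + ln ln ln(aⁿ)` implies
`bⁿ ≤ e^{e^{e^s}} aⁿ`. (Honest un-doing of the triple logarithm gives `ln(bⁿ) ≤ (ln(aⁿ))^{e^s}` only — see the module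
docstring; adjudication is the refuter's.) [claim: Ruzmaikina2008NSVorticityBounds, status: disputed] -/
def Inference50 : Prop :=
  ∀ τ : ℝ, 0 < τ → ∃ n₁ : ℕ, ∀ n : ℕ, n₁ ≤ n → ∀ s a b : ℝ, 0 ≤ s → s ≤ τ →
    Real.exp (Real.exp 1) ≤ a → Real.exp (Real.exp 1) ≤ b →
    lll (b ^ n) ≤ s + lll (a ^ n) → b ^ n ≤ Real.exp (Real.exp (Real.exp s)) * a ^ n

/-- **Step 5, maximally charitable quantifiers**: the same inference (49) ⇒ (50) p. 21 with the threshold `n₁` allowed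
to depend on the horizon `τ` AND on two-sided a priori bounds `e^e ≤ a ≤ A`, `e^e ≤ b ≤ B` for the norms ((47)'s
right-hand side dominates the Theorem-1 bound (44) for `|ω|_∞` on `[t₁,t₂]`). `Inference50 → Inference50Charitable`
(`inference50Charitable_of_inference50`), so a refutation of this form refutes Step 5.
[claim: Ruzmaikina2008NSVorticityBounds, status: disputed] -/
def Inference50Charitable : Prop :=
  ∀ τ A B : ℝ, 0 < τ → ∃ n₁ : ℕ, ∀ n : ℕ, n₁ ≤ n → ∀ s a b : ℝ, 0 ≤ s → s ≤ τ →
    Real.exp (Real.exp 1) ≤ a → a ≤ A → Real.exp (Real.exp 1) ≤ b → b ≤ B →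
    lll (b ^ n) ≤ s + lll (a ^ n) → b ^ n ≤ Real.exp (Real.exp (Real.exp s)) * a ^ n

/-- **Step 5, bare display**: (49) ⇒ (50) p. 21 for one `n ≥ 2`, `s ≥ 0`, `a, b ≥ e^e` (the strongest reading; it
implies `Inference50`, `inference50_of_pointwise`). [claim: Ruzmaikina2008NSVorticityBounds, status: disputed] -/
def Inference50Pointwise : Prop :=
  ∀ (n : ℕ) (s a b : ℝ), 2 ≤ n → 0 ≤ s → Real.exp (Real.exp 1) ≤ a → Real.exp (Real.exp 1) ≤ b →
    lll (b ^ n) ≤ s + lll (a ^ n) → b ^ n ≤ Real.exp (Real.exp (Real.exp s)) * a ^ n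

/-- `Inference50 → Inference50Charitable` (weakening: extra hypotheses on `a`, `b` ignored).
[cite: Ruzmaikina2008NSVorticityBounds, (50) p.21] -/
theorem inference50Charitable_of_inference50 (h : Inference50) : Inference50Charitable := by
  intro τ A B hτ
  obtain ⟨n₁, hn₁⟩ := h τ hτ
  exact ⟨n₁, fun n hn s a b hs hsτ ha _ hb _ hl => hn₁ n hn s a b hs hsτ ha hb hl⟩

/-- `Inference50Pointwise → Inference50` (take `n₁ = 2`). [cite: Ruzmaikina2008NSVorticityBounds, (50) p.21] -/
theorem inference50_of_pointwise (h : Inference50Pointwise) : Inference50 :=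
  fun _ _ => ⟨2, fun n hn s a b hs _ ha hb hl => h n s a b hn hs ha hb hl⟩

/-- **Step 6 — (51) [omginftestimate] p. 21, FIRST inequality**: "Therefore we obtain that for all `n` satisfying (47)
(51) `|ω|_n(t) ≤ e^{(1/n)e^{e^{t−t₁}}} |ω|_n(t₁)`" — the `n`-th root of (50), scalar grain (`a = |ω|_n(t₁)`,
`b = |ω|_n(t)`, nonnegative). True: PROVED below (`root51_holds`). [claim: Ruzmaikina2008NSVorticityBounds, status: disputed] -/
def Root51 : Prop :=
  ∀ (n : ℕ) (s a b : ℝ), 2 ≤ n → 0 ≤ a → 0 ≤ b →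
    b ^ n ≤ Real.exp (Real.exp (Real.exp s)) * a ^ n →
    b ≤ Real.exp ((1 / (n : ℝ)) * Real.exp (Real.exp s)) * a

/-- Step 6 is a theorem: `(e^{E} aⁿ)^{1/n} = e^{E/n} a`. [cite: Ruzmaikina2008NSVorticityBounds, (51) p.21] -/
theorem root51_holds : Root51 := by
  intro n s a b hn ha hb h
  have hn0 : n ≠ 0 := by omega
  have hE : Real.exp ((1 / (n : ℝ)) * Real.exp (Real.exp s)) ^ n = Real.exp (Real.exp (Real.exp s)) := by
    rw [← Real.exp_nat_mul]
    congr 1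
    field_simp
  have hrhs : 0 ≤ Real.exp ((1 / (n : ℝ)) * Real.exp (Real.exp s)) * a := mul_nonneg (Real.exp_nonneg _) ha
  refine le_of_pow_le_pow_left₀ hn0 hrhs ?_
  rw [mul_pow, hE]
  exact h

/-- **(51) second inequality p. 21 / (58) p. 22 / the chain "`|ω|₂(t) ≤ |ω|_∞(t)`" of (60)–(61) pp. 22–23**:
"`… |ω|_n(t₁) ≤ e^{(1/n)e^{e^{t−t₁}}} |ω|_∞(t₁)`", "`max(|ω|_n(t₁), e^e) ≤ … max(|ω|_∞(t₁), e^e)`", "`|ω|₂(t) ≤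
|ω|_∞(t) ≤ max(|ω|_∞(δ), e^e)`" — an `L^q(ℝ³)` norm bounded by the `L^∞(ℝ³)` norm with constant `1`. TYPED for the
vorticity slices of solutions in the class, `2 ≤ q < ∞`. Recorded for the map (MAP-SCHEMA §1b); NOT consumed by the
composition (the limits `n → ∞` at (52)/(59) need only the first inequality of (51), and the iteration of Theorem 3 only
the `|ω|_∞` bound). [claim: Ruzmaikina2008NSVorticityBounds, status: disputed] -/
def NormComparison : Prop :=
  ∀ (ν a b : ℝ) (u : ℝ → EuclideanSpace ℝ (Fin 3) → EuclideanSpace ℝ (Fin 3))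
    (p : ℝ → EuclideanSpace ℝ (Fin 3) → ℝ), 0 < ν → a < b → IsSolutionOn ν a b u p →
    ∀ q : ℝ≥0∞, 2 ≤ q → q ≠ ⊤ → ∀ t ∈ Icc a b, vortNorm q u t ≤ vortNorm ⊤ u t

/-- **Step 7 — "Taking `n → ∞`": (52) [omegainftestimate] p. 21 and (59) p. 22.** "(51) … for `t ∈ [t₁,t₂]`. Taking
`n → ∞` we obtain that (52) `|ω|_∞(t) ≤ |ω|_∞(t₁)`"; "(58) `|ω|_n(t) ≤ e^{(1/n)e^{e^{t−t₁}}} max(|ω|_n(t₁), e^e) …`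
Taking the limit `n → ∞` we obtain that (59) `|ω|_∞(t) ≤ max(|ω|_∞(t₁), e^e)`". TYPED in the class: an `n`-uniform
family of bounds `|ω|_n(t) ≤ e^{(1/n)e^{e^{t₂−t₁}}} max(|ω|_n(t₁), c)` for all `n ≥ n₂` gives `|ω|_∞(t) ≤
max(|ω|_∞(t₁), c)` (`c = 0`: (52); `c = e^e`: (59)). (True: `|ω|_n → |ω|_∞` for `ω ∈ L² ∩ L^∞`.)
[claim: Ruzmaikina2008NSVorticityBounds, status: disputed] -/
def LimitN : Prop :=
  ∀ (ν t₁ t₂ : ℝ) (u : ℝ → EuclideanSpace ℝ (Fin 3) → EuclideanSpace ℝ (Fin 3))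
    (p : ℝ → EuclideanSpace ℝ (Fin 3) → ℝ), 0 < ν → t₁ < t₂ → IsSolutionOn ν t₁ t₂ u p → ∀ c : ℝ, 0 ≤ c →
    ∀ n₂ : ℕ, (∀ n : ℕ, n₂ ≤ n → ∀ t ∈ Icc t₁ t₂,
      vortNorm n u t ≤ Real.exp ((1 / (n : ℝ)) * Real.exp (Real.exp (t₂ - t₁))) * max (vortNorm n u t₁) c) →
    ∀ t ∈ Icc t₁ t₂, vortNorm ⊤ u t ≤ max (vortNorm ⊤ u t₁) c

/-- **Step 8 — Proof of Theorem 2, Part 2 (p. 21–22, (53)–(58))**: "Suppose now that … `|ω|_n(t)` is a continuous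
function of `t` … By continuity of `|ω|_n(t)` … there exists a set consisting of a union of open intervals `∪ⱼIⱼ` such
that on each `Iⱼ`, `|ω|_n(t) < e^e` … `(∪ⱼIⱼ)ᶜ = ∪ₖI'ₖ` … `|ω|_n(t) ≥ e^e` for all `t ∈ I'ₖ` and `|ω|_n(t'_{1ₖ}) =
e^e` for `k > 1` … Then by formula (51) we obtain on each interval `I'ₖ` (53) … (58) `|ω|_n(t) ≤ e^{(1/n)e^{e^{t−t₁}}}
max(|ω|_n(t₁), e^e)`." SCALAR GRAIN over the continuous nonnegative function `f = |ω|_n(·)` on `[t₁,t₂]`: if the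
Part-1 mechanism ((51), first inequality) is available on every sub-interval `[a,b]` on which `f ≥ e^e`, then (58) with
the horizon `t₂ − t₁` in the exponent. (True: real analysis.) [claim: Ruzmaikina2008NSVorticityBounds, status: disputed] -/
def Part2 : Prop :=
  ∀ (n : ℕ) (t₁ t₂ : ℝ) (f : ℝ → ℝ), 2 ≤ n → t₁ < t₂ → ContinuousOn f (Icc t₁ t₂) →
    (∀ t ∈ Icc t₁ t₂, 0 ≤ f t) →
    (∀ a b : ℝ, t₁ ≤ a → a < b → b ≤ t₂ → (∀ t ∈ Icc a b, Real.exp (Real.exp 1) ≤ f t) →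
      ∀ t ∈ Icc a b, f t ≤ Real.exp ((1 / (n : ℝ)) * Real.exp (Real.exp (t - a))) * f a) →
    ∀ t ∈ Icc t₁ t₂, f t ≤ Real.exp ((1 / (n : ℝ)) * Real.exp (Real.exp (t₂ - t₁))) * max (f t₁) (Real.exp (Real.exp 1))

/-- **Step 9 — «implicit»: the continuity branch of Theorem 2's dichotomy hypothesis (p. 2), ASSUMED in the proofs of
Theorems 3 and 4 and never discharged in print** (p. 22: "Also assume that for all `n` large enough (`n` satisfying
(47) with `t₁ = δ`), `|ω|_n(t)` is continuous as a function of `t` for all `t ∈ [0,T)`"; p. 23: "Suppose also that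
there exists `n₀` (satisfying (47) with `t₁ = δ`) such that for all `n > n₀`, `|ω|_n(t)` is a continuous function of `t`
for all `t ∈ [0,T)`"). TYPED in the class: `t ↦ |ω|_n(t)` is continuous on `[t₁,t₂]` for `n ≥ 2`. (True, classical: the
vorticity equation bounds `∂ₜω` in `L² ∩ L^∞` in the class.) [claim: Ruzmaikina2008NSVorticityBounds, status: disputed] -/
def ImplicitContinuity : Prop :=
  ∀ (ν t₁ t₂ : ℝ) (u : ℝ → EuclideanSpace ℝ (Fin 3) → EuclideanSpace ℝ (Fin 3))
    (p : ℝ → EuclideanSpace ℝ (Fin 3) → ℝ), 0 < ν → t₁ < t₂ → IsSolutionOn ν t₁ t₂ u p → ∀ n : ℕ, 2 ≤ n →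
    ContinuousOn (fun t => vortNorm n u t) (Icc t₁ t₂)

/-- The local step as the proof of Theorem 3 uses [Ku] (p. 22): with the constant `C`, from every slice `v` of the class
with `sup|∇ × v| ≤ M` (`0 < M`) at time `τ`, a solution in the class on `[τ, τ + ν/(2CM²)]` starting at `v`.
[cite: Ruzmaikina2008NSVorticityBounds, Proof of Theorem 3 p.22] -/
def LocalStep (C ν : ℝ) : Prop :=
  ∀ (τ M : ℝ) (v : EuclideanSpace ℝ (Fin 3) → EuclideanSpace ℝ (Fin 3)), 0 < M → IsDatum v →
    (∀ x, ‖curl v x‖ ≤ M) →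
    ∃ (u : ℝ → EuclideanSpace ℝ (Fin 3) → EuclideanSpace ℝ (Fin 3)) (p : ℝ → EuclideanSpace ℝ (Fin 3) → ℝ),
      IsSolutionOn ν τ (τ + ν / (2 * C * M ^ 2)) u p ∧ u τ = v

/-- **Step 10 — the local existence theorem as imported (p. 22)**: "by the Local Existence and Uniqueness Theorem (see
Theorem 4.2 in [Ku], where we take `p = 2` and `M_{2p} = |ω|_∞(0)`) there exists `t₀ = ν/(2C|ω|_∞²(0))` such that
for `t ∈ [0,t₀]`, we have that there exists a unique solution such that `|ω|₂(t) < ∞` and also by the analyticity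
results … `|ω|_∞(δ) < ∞`, `|∇ω|_{3+ε}(δ) < ∞` …"; p. 22 restatement of Thm 3: "`C` is a constant independent of `ω`,
`ν`, etc."; [Ku] = I. Kukavica, *On the dissipative scale for the Navier–Stokes equations*, IUMJ 48 (1999). TYPED as
used: ONE constant `C > 0` serving every `ν > 0` (`LocalStep C ν`; uniqueness and the finiteness of the norms at
interior times hold in the class). Flag (not asserted either way): `ν/|ω|_∞²` is not a time under the Navier–Stokes
scaling. [claim: Ruzmaikina2008NSVorticityBounds, status: disputed] -/
def KuLocal : Prop :=
  ∃ C : ℝ, 0 < C ∧ ∀ ν : ℝ, 0 < ν → LocalStep C ν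

/-- **Step 11 — the iteration (p. 22–23, up to (61))**: "Now let `t₀' = ν/(2C max(|ω|_∞²(δ), e^{2e}))` and consider
`t ∈ [δ, δ+t₀']`. Using `ω(x,δ)` as the initial condition … there exists a unique solution … By Theorem 1, Theorem 2
and arguments above … `|ω|₂(t) ≤ |ω|_∞(t) ≤ max(|ω|_∞(δ), e^e)` … Repeating this argument `k` times … For any `T > 0`,
we can continue this argument up to `k` such that `k ≥ T/t₀'`, to obtain that there exists a unique solution of the 3D
Navier Stokes Equation on `[0,T]`" with (61). TYPED: at viscosity `ν`, the local step with constant `C` (`LocalStep`)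
and the a priori bound (59) for every solution on every interval (`AprioriBound59`) give, for every datum and every
`T > 0`, a solution on `[0,T]`. (True, classical: first step of length `ν/(2CM₀²)`, then steps of the uniform length
`ν/(2C max(M₀,e^e)²)`, restart-and-glue with uniqueness; tree `IsClassicalNSSolutionOn.glue`.)
[claim: Ruzmaikina2008NSVorticityBounds, status: disputed] -/
def Iteration : Prop :=
  ∀ (C ν : ℝ), 0 < C → 0 < ν → LocalStep C ν → AprioriBound59 ν →
    ∀ u₀ : EuclideanSpace ℝ (Fin 3) → EuclideanSpace ℝ (Fin 3), IsDatum u₀ → ∀ T : ℝ, 0 < T →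
      ∃ (u : ℝ → EuclideanSpace ℝ (Fin 3) → EuclideanSpace ℝ (Fin 3)) (p : ℝ → EuclideanSpace ℝ (Fin 3) → ℝ),
        IsSolution ν T u₀ u p

/-! ### Kernel relations: the compositions (the printed logic composes once (50) is granted) -/

/-- **Steps 1–9 give Theorem 2's conclusion (59) in the class.** For a solution on `[a₀,b₀]`: `N` and `n₀` from
Step 1; the threshold `n₁` of Step 5 for the horizon `b₀ − a₀`; for every `n ≥ max(n₀,n₁)` the Part-1 mechanism holds
on every sub-interval `[a,b]` where `|ω|_n ≥ e^e` (Step 2 ⇒ Step 3 with `X = |ω|_nⁿ ≥ (e^e)ⁿ` and `K < ln n₀ ≤ ln n`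
⇒ Step 4 ⇒ Step 5 at `s = t − a` ⇒ Step 6), so Part 2 (Step 8, with the continuity of Step 9) yields (58) for all
these `n`, and Step 7 takes `n → ∞`. Pure logic; nothing asserted. [claim: Ruzmaikina2008NSVorticityBounds, status: disputed] -/
theorem theorem2_of_steps (h1 : Theorem1) (h2 : Ineq45) (h3 : Ineq48) (h4 : Ineq49) (h5 : Inference50)
    (h6 : Root51) (h7 : LimitN) (h8 : Part2) (h9 : ImplicitContinuity) : Theorem2 := by
  intro ν hν a₀ b₀ u p hab hsol t ht
  obtain ⟨N, hN, hens, n₀, hn₀, hK⟩ := h1 ν a₀ b₀ u p hν hab hsol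
  obtain ⟨n₁, h5'⟩ := h5 (b₀ - a₀) (sub_pos.2 hab)
  have hE0 : (0 : ℝ) ≤ Real.exp (Real.exp 1) := (Real.exp_pos _).le
  refine h7 ν a₀ b₀ u p hν hab hsol (Real.exp (Real.exp 1)) hE0 (max n₀ n₁) ?_ t ht
  intro n hn s hs
  have hn0 : n₀ ≤ n := le_trans (le_max_left _ _) hn
  have hn1 : n₁ ≤ n := le_trans (le_max_right _ _) hn
  have hn2 : 2 ≤ n := le_trans hn₀ hn0
  -- `K < ln n₀ ≤ ln n` on `[a₀,b₀]` ((46)/(47))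
  have hKn : ∀ τ ∈ Icc a₀ b₀, kFun N u τ < Real.log n := by
    intro τ hτ
    have hn₀pos : (0 : ℝ) < n₀ := by exact_mod_cast (show 0 < n₀ by omega)
    exact lt_of_lt_of_le (hK τ hτ) (Real.log_le_log hn₀pos (by exact_mod_cast hn0))
  have hnn : ∀ τ, 0 ≤ vortNorm n u τ := fun τ => ENNReal.toReal_nonneg
  -- Part 2 for `f = |ω|_n(·)`, continuous by Step 9
  refine h8 n a₀ b₀ (fun τ => vortNorm n u τ) hn2 hab (h9 ν a₀ b₀ u p hν hab hsol n hn2) (fun τ _ => hnn τ) ?_ s hs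
  -- the Part-1 mechanism on a sub-interval `[a,b]` with `|ω|_n ≥ e^e`
  intro a b ha hab' hb hge τ hτ
  have hsol' : IsSolutionOn ν a b u p := hsol.mono ha hab' hb
  have hsub : Icc a b ⊆ Icc a₀ b₀ := Icc_subset_Icc ha hb
  -- Step 2 on `[a,b]`
  have hD := h2 ν a b u p hν hab' hsol' N hN (fun σ hσ => hens σ (hsub hσ)) n hn2
  -- Step 3: `X = |ω|_nⁿ ≥ (e^e)ⁿ`, `K < ln n`
  have hX : ∀ σ ∈ Icc a b, Real.exp (Real.exp 1) ^ n ≤ vortNorm n u σ ^ n := fun σ hσ =>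
    pow_le_pow_left₀ hE0 (hge σ hσ) n
  have hL := h3 n a b (fun σ => vortNorm n u σ ^ n) (kFun N u) hn2 hab' hX hD (fun σ hσ => hKn σ (hsub hσ))
  -- Step 4: (49)
  have h49 := h4 a b (fun σ => lll (vortNorm n u σ ^ n)) hab' hL τ hτ
  -- Step 5: (50) at `s = τ − a`
  have hs0 : 0 ≤ τ - a := sub_nonneg.2 hτ.1
  have hsτ : τ - a ≤ b₀ - a₀ := by linarith [hτ.2]
  have h50 := h5' n hn1 (τ - a) (vortNorm n u a) (vortNorm n u τ) hs0 hsτ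
    (hge a (left_mem_Icc.2 hab'.le)) (hge τ hτ) h49
  -- Step 6: (51)
  exact h6 n (τ - a) (vortNorm n u a) (vortNorm n u τ) hn2 (hnn a) (hnn τ) h50

/-- **Composition — Steps 1–11 in the printed order give Theorem 3 (rendered).** Existence on `[0,T]`: the constant `C`
and the local step of Step 10, the a priori bound (59) from Steps 1–9 (`theorem2_of_steps`), and the iteration of
Step 11. Uniqueness on `[0,T]` (the paper: from [Ku]'s local uniqueness): the tree's discharged uniqueness theorem in the
class `IsClassicalNSSolutionOn.eq_of_hasBoundedSobolevNormsOn` (Majda–Bertozzi Cor. 3.1, `ν ≥ 0`). Pure logic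
otherwise; nothing asserted. [claim: Ruzmaikina2008NSVorticityBounds, status: disputed] -/
theorem claim_of_steps (h1 : Theorem1) (h2 : Ineq45) (h3 : Ineq48) (h4 : Ineq49) (h5 : Inference50)
    (h6 : Root51) (h7 : LimitN) (h8 : Part2) (h9 : ImplicitContinuity) (h10 : KuLocal) (h11 : Iteration) :
    ClaimedTheorem := by
  intro ν hν u₀ hu₀ T hT
  refine ⟨?_, ?_⟩
  · obtain ⟨C, hC, hloc⟩ := h10
    exact h11 C ν hC hν (hloc ν hν) (theorem2_of_steps h1 h2 h3 h4 h5 h6 h7 h8 h9 ν hν) u₀ hu₀ T hT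
  · intro u p u' p' hu hu' t ht
    have h0 : u' 0 = u 0 := by rw [hu'.initial, hu.initial]
    exact hu'.sol.isClassical.eq_of_hasBoundedSobolevNormsOn hu.sol.isClassical hν.le hT hu'.sol.sobolev
      hu.sol.sobolev h0 ht

/-- Same composition with the bare display `Inference50Pointwise` in place of Step 5.
[claim: Ruzmaikina2008NSVorticityBounds, status: disputed] -/
theorem claim_of_steps_pointwise (h1 : Theorem1) (h2 : Ineq45) (h3 : Ineq48) (h4 : Ineq49)
    (h5 : Inference50Pointwise) (h6 : Root51) (h7 : LimitN) (h8 : Part2) (h9 : ImplicitContinuity) (h10 : KuLocal)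
    (h11 : Iteration) : ClaimedTheorem :=
  claim_of_steps h1 h2 h3 h4 (inference50_of_pointwise h5) h6 h7 h8 h9 h10 h11

/-! ### Clay link (TYPING-HYGIENE §10 (b)): per-horizon solutions versus Clay (A) -/

/-- **`ClayDelta`** (axis Δ6 FORM OF THE CONCLUSION, horizon): Theorem 3 is printed PER HORIZON ("for any `T > 0` …
on `[0,T]`", with uniqueness), while Clay (A) asks for ONE solution on `ℝ³ × [0,∞)`. The delta is the classical
patching statement: unique solutions on the nested intervals `[0,T]` define a global solution in the class. (Pure
bookkeeping; not a «wrong problem» axis.) [cite: FeffermanClay2006, statement (A)] -/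
def ClayDelta : Prop :=
  ∀ ν : ℝ, 0 < ν → ∀ u₀ : EuclideanSpace ℝ (Fin 3) → EuclideanSpace ℝ (Fin 3), IsDatum u₀ →
    (∀ T : ℝ, 0 < T →
      ∃ (u : ℝ → EuclideanSpace ℝ (Fin 3) → EuclideanSpace ℝ (Fin 3)) (p : ℝ → EuclideanSpace ℝ (Fin 3) → ℝ),
        IsSolution ν T u₀ u p) →
    (∀ T : ℝ, 0 < T →
      ∀ (u : ℝ → EuclideanSpace ℝ (Fin 3) → EuclideanSpace ℝ (Fin 3)) (p : ℝ → EuclideanSpace ℝ (Fin 3) → ℝ)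
        (u' : ℝ → EuclideanSpace ℝ (Fin 3) → EuclideanSpace ℝ (Fin 3)) (p' : ℝ → EuclideanSpace ℝ (Fin 3) → ℝ),
        IsSolution ν T u₀ u p → IsSolution ν T u₀ u' p' → ∀ t ∈ Icc 0 T, u' t = u t) →
    ∃ (u : ℝ → EuclideanSpace ℝ (Fin 3) → EuclideanSpace ℝ (Fin 3)) (p : ℝ → EuclideanSpace ℝ (Fin 3) → ℝ),
      IsGlobalSolution ν u₀ u p

/-- **`ClayDelta → ClaimedTheorem → clayR3.Regularity`** (Clay (A), token-for-token the summit body via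
`ClayVariants`): a Clay datum (smooth, divergence free, rapid decay (4)) is a datum of the class (Schwartz ⇒ `H^∞`, tree
`HasRapidSpatialDecay.lintegral_enorm_iteratedFDeriv_sq_lt_top`); the patched global solution is smooth on
`ℝ³ × [0,∞)` with `u(0) = u₀` (bridge `isNavierStokesSolution_and_smooth_iff`), and the energy bound (7) holds with
`C = ∫|u₀|²` by the tree's energy inequality in the BKM class (`IsClassicalNSSolutionOn.bkm_energy_le`,
Majda–Bertozzi Prop. 3.1) — the argument of C17 `Chae2007.clay_of_claimedNS`.
[cite: FeffermanClay2006, statement (A), CMI offprint p. 2] -/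
theorem clay_of_claimed_of_delta (hΔ : ClayDelta) (h : ClaimedTheorem) : ClayVariants.clayR3.Regularity := by
  intro ν hν u₀ hu₀ hdiv hdecay
  have hdat : IsDatum u₀ :=
    ⟨hu₀, fun x => hdiv x, fun n => hdecay.lintegral_enorm_iteratedFDeriv_sq_lt_top n⟩
  obtain ⟨u, p, hsol⟩ :=
    hΔ ν hν u₀ hdat (fun T hT => (h ν hν u₀ hdat T hT).1) (fun T hT => (h ν hν u₀ hdat T hT).2)
  obtain ⟨hns, hsu, hsp⟩ :=
    (isNavierStokesSolution_and_smooth_iff (ν := ν) (f := 0) (u₀ := u₀) (u := u) (p := p)).2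
      ⟨hsol.isClassical, hsol.initial⟩
  refine ⟨u, p, hsu, hsp, hns, ?_⟩
  show HasBoundedEnergy u
  -- finite energy of the slices and the identity `∫⁻ ‖u t‖ₑ² = ofReal (∫ ‖u t‖²)` in the class
  have key : ∀ S : ℝ, 0 < S → ∀ τ ∈ Icc (0:ℝ) S,
      ∫⁻ x, ‖u τ x‖ₑ ^ 2 = ENNReal.ofReal (∫ x, ‖u τ x‖ ^ 2) := by
    intro S hS τ hτ
    have hcl : IsClassicalNSSolutionOn (Icc 0 S) ν 0 u p :=
      hsol.isClassical.mono Icc_subset_Ici_self (uniqueDiffOn_Icc hS)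
    obtain ⟨C, hC⟩ := hsol.sobolev S 0
    have hfin0 : ∫⁻ x, ‖iteratedFDeriv ℝ 0 (u τ) x‖ₑ ^ 2 < ⊤ := (hC τ hτ).trans_lt ENNReal.coe_lt_top
    have heq : (fun x => ‖iteratedFDeriv ℝ 0 (u τ) x‖ₑ ^ 2) = fun x => ‖u τ x‖ₑ ^ 2 := by
      funext x
      rw [← ofReal_norm, norm_iteratedFDeriv_zero, ofReal_norm]
    have hfin : ∫⁻ x, ‖u τ x‖ₑ ^ 2 < ⊤ := by rwa [heq] at hfin0
    have hint : Integrable (fun x => ‖u τ x‖ ^ 2) :=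
      integrable_sq_norm_of_lintegral_lt_top (hcl.contDiff_velocity hτ).continuous hfin
    rw [ofReal_integral_eq_lintegral_ofReal hint (Eventually.of_forall fun x => sq_nonneg _)]
    refine lintegral_congr fun x => ?_
    rw [← ofReal_norm, ENNReal.ofReal_pow (norm_nonneg _)]
  refine ⟨∫⁻ x, ‖u₀ x‖ₑ ^ 2, ?_, fun t ht => ?_⟩
  · have h0 := hdat.2.2 0
    have heq : (fun x => ‖iteratedFDeriv ℝ 0 u₀ x‖ₑ ^ 2) = fun x => ‖u₀ x‖ₑ ^ 2 := by
      funext x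
      rw [← ofReal_norm, norm_iteratedFDeriv_zero, ofReal_norm]
    rwa [heq] at h0
  · have hT : (0:ℝ) < t + 1 := by linarith
    have hcl : IsClassicalNSSolutionOn (Icc 0 (t + 1)) ν 0 u p :=
      hsol.isClassical.mono Icc_subset_Ici_self (uniqueDiffOn_Icc hT)
    have hE : ∫ x, ‖u t x‖ ^ 2 ≤ ∫ x, ‖u 0 x‖ ^ 2 :=
      hcl.bkm_energy_le hν.le hT (hsol.sobolev (t + 1)) ⟨ht, by linarith⟩
    rw [key (t + 1) hT t ⟨ht, by linarith⟩, ← hsol.initial, key (t + 1) hT 0 ⟨le_rfl, hT.le⟩]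
    exact ENNReal.ofReal_le_ofReal hE

/-! ### v2 (append): the bare slice form of «`|ω|_q ≤ |ω|_∞`» (asked by ns-claims-ref-1 / ns-claims-refuter-2),
Step 4 is a theorem, and kernel plumbing reducing `¬ Inference50` to two displayed real inequalities -/

/-- The time slices of a solution in the class are data of the class (smooth, divergence free, every derivative in
`L²`). [cite: Ruzmaikina2008NSVorticityBounds, Proof of Theorem 3 p.22 ("Using `ω(x,δ)` as the initial condition")] -/
theorem isDatum_slice {ν a b : ℝ} {u : ℝ → EuclideanSpace ℝ (Fin 3) → EuclideanSpace ℝ (Fin 3)}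
    {p : ℝ → EuclideanSpace ℝ (Fin 3) → ℝ} (h : IsSolutionOn ν a b u p) {t : ℝ} (ht : t ∈ Icc a b) :
    IsDatum (u t) := by
  refine ⟨h.isClassical.contDiff_velocity ht, h.isClassical.divFree t ht, fun n => ?_⟩
  obtain ⟨C, hC⟩ := h.sobolev n
  exact (hC t ht).trans_lt ENNReal.coe_lt_top

/-- **(51) second inequality p. 21 / (58) second inequality p. 22 / "`|ω|₂(t) ≤ |ω|_∞(t)`" in (60) p. 22 and (61)
p. 23 — BARE SLICE FORM** (the grain at which the print uses it: an inequality between two norms of the vorticity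
field at one time, no property of the solution invoked): for the vorticity field `∇ × v` of ANY datum `v` of the
class and any `2 ≤ q < ∞`, `‖∇ × v‖_{L^q(ℝ³)} ≤ ‖∇ × v‖_{L^∞(ℝ³)}`. Recorded for the map (downstream of Step 5);
NOT consumed by the composition. `NormComparisonSlice → NormComparison` (`normComparison_of_slice`).
[claim: Ruzmaikina2008NSVorticityBounds, status: disputed] -/
def NormComparisonSlice : Prop :=
  ∀ v : EuclideanSpace ℝ (Fin 3) → EuclideanSpace ℝ (Fin 3), IsDatum v → ∀ q : ℝ≥0∞, 2 ≤ q → q ≠ ⊤ →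
    (eLpNorm (curl v) q volume).toReal ≤ (eLpNorm (curl v) ⊤ volume).toReal

/-- The slice form implies the solution form. [cite: Ruzmaikina2008NSVorticityBounds, (58) p.22] -/
theorem normComparison_of_slice (h : NormComparisonSlice) : NormComparison :=
  fun _ _ _ u _ _ _ hsol q hq hq' t ht => h (u t) (isDatum_slice hsol ht) q hq hq'

/-- **Step 4 is a theorem** ((49) p. 20 from (48): a function with derivative `≤ 1` within `[a,b]` grows with slope
at most `1`; mean value theorem). [cite: Ruzmaikina2008NSVorticityBounds, (49) p.20] -/
theorem ineq49_holds : Ineq49 := by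
  intro a b F hab hF t ht
  have hcont : ContinuousOn F (Icc a b) := fun x hx => by
    obtain ⟨D, hD, -⟩ := hF x hx
    exact hD.continuousWithinAt
  have hder : ∀ x ∈ Ioo a b, ∃ D, HasDerivAt F D x ∧ D ≤ 1 := fun x hx => by
    obtain ⟨D, hD, hD1⟩ := hF x (Ioo_subset_Icc_self hx)
    exact ⟨D, hD.hasDerivAt (Icc_mem_nhds hx.1 hx.2), hD1⟩
  have hdiff : DifferentiableOn ℝ F (interior (Icc a b)) := by
    rw [interior_Icc]
    intro x hx
    obtain ⟨D, hD, -⟩ := hder x hx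
    exact hD.differentiableAt.differentiableWithinAt
  have hle : ∀ x ∈ interior (Icc a b), deriv F x ≤ 1 := by
    rw [interior_Icc]
    intro x hx
    obtain ⟨D, hD, hD1⟩ := hder x hx
    rwa [hD.deriv]
  have := (convex_Icc a b).image_sub_le_mul_sub_of_deriv_le hcont hdiff hle a (left_mem_Icc.2 hab.le) t ht ht.1
  linarith

/-- **Kernel plumbing for the refutation of Step 5** (asserts nothing): `¬ Inference50` follows from the two displayed
real inequalities at the `n`-uniform witness `s = 1`, `a = |ω|_n(t₁) = e^e`, `b = |ω|_n(t) = e^{e+1}` — (49) holds at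
the witness for every `n ≥ 16`, and (50) fails there for every `n ≥ 16` (the horizon `τ = 1`, exponent
`n = max(n₁, 16)`). [cite: Ruzmaikina2008NSVorticityBounds, (49)–(50) p.20–21] -/
theorem not_inference50_of_witness
    (h49 : ∀ n : ℕ, 16 ≤ n →
      lll (Real.exp (Real.exp 1 + 1) ^ n) ≤ 1 + lll (Real.exp (Real.exp 1) ^ n))
    (h50 : ∀ n : ℕ, 16 ≤ n →
      Real.exp (Real.exp (Real.exp 1)) * Real.exp (Real.exp 1) ^ n < Real.exp (Real.exp 1 + 1) ^ n) :
    ¬ Inference50 := by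
  intro H
  obtain ⟨n₁, hn₁⟩ := H 1 one_pos
  have hge : n₁ ≤ max n₁ 16 := le_max_left _ _
  have h16 : 16 ≤ max n₁ 16 := le_max_right _ _
  have he : Real.exp (Real.exp 1) ≤ Real.exp (Real.exp 1 + 1) := Real.exp_le_exp.2 (by linarith)
  have h := hn₁ (max n₁ 16) hge 1 (Real.exp (Real.exp 1)) (Real.exp (Real.exp 1 + 1)) zero_le_one le_rfl
    le_rfl he (h49 (max n₁ 16) h16)
  exact (not_le.2 (h50 (max n₁ 16) h16)) h

/-! ### Discharge of `ClayDelta` (ns-claims-lit-4 g4): the per-horizon ⇒ global patching is a theorem -/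

/-- **`ClayDelta` holds.** Per-horizon solutions of the class on every `[0,T]`, unique on each `[0,T]`, patch to ONE
global solution of the class: the generic patching lemma `IsClassicalNSSolutionOn.exists_Ici_of_forall_Icc_of_unique`
(`Literature/Analysis/FluidPDE/ClassicalNSHorizonPatching.lean`) with the class `Q T u p := IsSolution ν T u₀ u p`;
uniqueness across two horizons is the per-horizon uniqueness on the shorter slab `[0,t]` (restriction
`IsClassicalNSSolutionOn.mono` / `HasBoundedSobolevNormsOn.mono`); the Sobolev bounds of the patched solution on
`[0,T]` are those of the member it coincides with there (slices verbatim). No hypothesis on the datum is used.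
[cite: FeffermanClay2006, statement (A)] [cite: RobinsonRodrigoSadowskiCUP2016, §8.1] -/
theorem clayDelta_holds : ClayDelta := by
  intro ν _hν u₀ _hu₀ hex huniq
  -- uniqueness across horizons from the printed per-horizon uniqueness
  have huniq' : ∀ (T₁ T₂ : ℝ) (U₁ : ℝ → EuclideanSpace ℝ (Fin 3) → EuclideanSpace ℝ (Fin 3))
      (P₁ : ℝ → EuclideanSpace ℝ (Fin 3) → ℝ) (U₂ : ℝ → EuclideanSpace ℝ (Fin 3) → EuclideanSpace ℝ (Fin 3))
      (P₂ : ℝ → EuclideanSpace ℝ (Fin 3) → ℝ),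
      IsSolution ν T₁ u₀ U₁ P₁ → IsSolution ν T₂ u₀ U₂ P₂ → ∀ t ∈ Icc 0 T₁, t ≤ T₂ → U₁ t = U₂ t := by
    intro T₁ T₂ U₁ P₁ U₂ P₂ h₁ h₂ t ht htT₂
    rcases ht.1.eq_or_lt with h00 | ht0
    · subst h00
      rw [h₁.initial, h₂.initial]
    · have h₁' : IsSolution ν t u₀ U₁ P₁ :=
        ⟨⟨h₁.sol.isClassical.mono (Icc_subset_Icc_right ht.2) (uniqueDiffOn_Icc ht0),
          h₁.sol.sobolev.mono (Icc_subset_Icc_right ht.2)⟩, h₁.initial⟩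
      have h₂' : IsSolution ν t u₀ U₂ P₂ :=
        ⟨⟨h₂.sol.isClassical.mono (Icc_subset_Icc_right htT₂) (uniqueDiffOn_Icc ht0),
          h₂.sol.sobolev.mono (Icc_subset_Icc_right htT₂)⟩, h₂.initial⟩
      exact huniq t ht0 U₂ P₂ U₁ P₁ h₂' h₁' t ⟨ht0.le, le_rfl⟩
  obtain ⟨u, p, hcl, h0, -, hloc⟩ := IsClassicalNSSolutionOn.exists_Ici_of_forall_Icc_of_unique
    (fun T U P => IsSolution ν T u₀ U P) (fun T U P h => ⟨h.sol.isClassical, h.initial⟩) hex huniq'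
  refine ⟨u, p, hcl, h0, fun T => ?_⟩
  -- on `[0, max T 1]` the patched solution is one of the given ones; restrict its Sobolev bounds
  obtain ⟨T', U, P, hTT', hUP, hu, -⟩ := hloc (max T 1) (lt_of_lt_of_le one_pos (le_max_right _ _))
  intro n
  obtain ⟨C, hC⟩ := hUP.sol.sobolev n
  refine ⟨C, fun t ht => ?_⟩
  have ht' : t ∈ Icc 0 (max T 1) := ⟨ht.1, ht.2.trans (le_max_left _ _)⟩
  rw [hu t ht']
  exact hC t ⟨ht.1, ht'.2.trans hTT'⟩

/-- **Clay (A) from the claimed theorem, the bookkeeping discharged** (`clay_of_claimed_of_delta` with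
`clayDelta_holds`): `ClaimedTheorem → clayR3.Regularity` with no residual hypothesis — the row's Clay delta is none
in the kernel. [cite: FeffermanClay2006, statement (A)] -/
theorem clay_of_claimed (h : ClaimedTheorem) : ClayVariants.clayR3.Regularity :=
  clay_of_claimed_of_delta clayDelta_holds h

/-! ### Kernel certificate (D-0026 debt pass, 2026-08-27): Step 7 `LimitN` is TRUE in the class

APPEND-ONLY addition after ADJUDICATED #39 (locator `Inference50`, class false lemma — UNTOUCHED): the limit step
«taking `n → ∞`» ((52) p.21 / (59) p.22) is discharged in the rendered class. Nothing else in this file is edited. -/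

/-- `∫⁻ ‖f‖ₑⁿ ≤ (ess sup ‖f‖ₑ)ⁿ⁻² · ∫⁻ ‖f‖ₑ²` for `n ≥ 2`. [folklore] -/
private theorem lintegral_pow_le_essSup_pow_mul
    (f : EuclideanSpace ℝ (Fin 3) → EuclideanSpace ℝ (Fin 3)) {n : ℕ} (hn : 2 ≤ n)
    (hE : eLpNormEssSup f volume ≠ ⊤) :
    ∫⁻ x, ‖f x‖ₑ ^ n ≤ eLpNormEssSup f volume ^ (n - 2) * ∫⁻ x, ‖f x‖ₑ ^ 2 := by
  rw [← lintegral_const_mul' _ _ (ENNReal.pow_ne_top hE)]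
  refine lintegral_mono_ae ?_
  filter_upwards [ae_le_eLpNormEssSup (μ := volume) (f := f)] with x hx
  obtain ⟨k, rfl⟩ := Nat.exists_eq_add_of_le hn
  rw [Nat.add_sub_cancel_left, add_comm, pow_add]
  exact mul_le_mul' (pow_le_pow_left' hx k) le_rfl

/-- Markov from below: `(ofReal L)ⁿ · vol{L < ‖f‖} ≤ ∫⁻ ‖f‖ₑⁿ`. [folklore] -/
private theorem pow_mul_measure_le_lintegral_pow
    {f : EuclideanSpace ℝ (Fin 3) → EuclideanSpace ℝ (Fin 3)} (hf : Continuous f) (L : ℝ) (n : ℕ) :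
    ENNReal.ofReal L ^ n * volume {x | L < ‖f x‖} ≤ ∫⁻ x, ‖f x‖ₑ ^ n := by
  have hmeas : AEMeasurable (fun x => ‖f x‖ₑ ^ n) volume :=
    (hf.measurable.enorm.pow_const n).aemeasurable
  refine le_trans ?_ (mul_meas_ge_le_lintegral₀ hmeas (ENNReal.ofReal L ^ n))
  refine mul_le_mul' le_rfl (measure_mono fun x hx => ?_)
  simp only [mem_setOf_eq] at hx ⊢
  refine pow_le_pow_left' ?_ n
  rw [← ofReal_norm]
  exact ENNReal.ofReal_le_ofReal hx.le

/-- `b^{1/n} → 1` for `b > 0`. [folklore] -/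
private theorem tendsto_rpow_one_div_nat {b : ℝ} (hb : 0 < b) :
    Tendsto (fun n : ℕ => b ^ (1 / (n : ℝ))) atTop (𝓝 1) := by
  have h1 : Tendsto (fun n : ℕ => (1 : ℝ) / (n : ℝ)) atTop (𝓝 0) := tendsto_one_div_atTop_nhds_zero_nat
  have h2 := ((Real.continuousAt_const_rpow hb.ne').tendsto).comp h1
  rw [Real.rpow_zero] at h2
  exact h2

/-- `a^{1 − 2/n} → a` for `a ≥ 0`. [folklore] -/
private theorem tendsto_rpow_one_sub_two_div_nat {a : ℝ} (ha : 0 ≤ a) :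
    Tendsto (fun n : ℕ => a ^ (1 - 2 / (n : ℝ))) atTop (𝓝 a) := by
  have h1 : Tendsto (fun n : ℕ => (1 : ℝ) - 2 / (n : ℝ)) atTop (𝓝 1) := by
    have := (tendsto_const_div_atTop_nhds_zero_nat (2 : ℝ))
    simpa using (tendsto_const_nhds (x := (1 : ℝ))).sub this
  rcases ha.eq_or_lt with rfl | ha'
  · -- `0 ^ (1 - 2/n) = 0` for `n ≥ 3`
    refine tendsto_const_nhds.congr' ?_
    filter_upwards [eventually_ge_atTop 3] with n hn
    have hn' : (3 : ℝ) ≤ n := by exact_mod_cast hn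
    have : (1 : ℝ) - 2 / (n : ℝ) ≠ 0 := by
      have : (2 : ℝ) / n < 1 := by rw [div_lt_one (by linarith)]; linarith
      linarith
    rw [Real.zero_rpow this]
  · have h2 := ((Real.continuousAt_const_rpow ha'.ne').tendsto).comp h1
    rw [Real.rpow_one] at h2
    exact h2

/-- `exp(K/n) → 1`. [folklore] -/
private theorem tendsto_exp_div_nat (K : ℝ) :
    Tendsto (fun n : ℕ => Real.exp (K / (n : ℝ))) atTop (𝓝 1) := by
  have h1 : Tendsto (fun n : ℕ => K / (n : ℝ)) atTop (𝓝 0) := tendsto_const_div_atTop_nhds_zero_nat K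
  have h2 := (Real.continuous_exp.tendsto 0).comp h1
  rw [Real.exp_zero] at h2
  exact h2

/-- The `Lⁿ` norm with `n : ℕ`, `n ≥ 1`, as a real power of the real integral (finite case). [folklore] -/
private theorem toReal_eLpNorm_nat (f : EuclideanSpace ℝ (Fin 3) → EuclideanSpace ℝ (Fin 3)) {n : ℕ}
    (hn : 1 ≤ n) :
    (eLpNorm f (n : ℝ≥0∞) volume).toReal = ((∫⁻ x, ‖f x‖ₑ ^ n).toReal) ^ (1 / (n : ℝ)) := by
  have hn0 : (n : ℝ≥0∞) ≠ 0 := by exact_mod_cast (Nat.one_le_iff_ne_zero.1 hn)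
  rw [eLpNorm_eq_lintegral_rpow_enorm_toReal hn0 (ENNReal.natCast_ne_top n), ENNReal.toReal_natCast,
    ENNReal.toReal_rpow]
  congr 2
  refine lintegral_congr fun x => ?_
  rw [ENNReal.rpow_natCast]

/-- **Step 7 `LimitN` HOLDS** ((52) p. 21 / (59) p. 22 «Taking `n → ∞`»; the typist's flag «True: `|ω|_n → |ω|_∞`
for `ω ∈ L² ∩ L^∞`» made a kernel fact). In the class a slice `ω = ∇ × u(·,s)` is continuous, bounded (Sobolev
imbedding, tree `exists_enorm_curl_le_of_hasBoundedSobolevNormsOn`) and square integrable (`lintegral_curl_sq_le`),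
so every `|ω|_n(s)`, `n ≥ 2`, is an honest real number and (i) `|ω|_n(t₁) ≤ |ω|_∞(t₁)^{1−2/n} (∫|ω|²(t₁))^{1/n}`
(`∫|ω|ⁿ ≤ |ω|_∞^{n−2}∫|ω|²`), (ii) `|ω|_n(t) ≥ L · vol{|ω(·,t)| > L}^{1/n}` for every `L` (Chebyshev from below; the
set is open and non-empty, hence of positive finite volume, whenever `0 < L < |ω|_∞(t)`). If the conclusion failed,
pick `max(|ω|_∞(t₁), c) < L < |ω|_∞(t)`; the `n`-uniform hypothesis squeezed between (ii) and (i) gives, as `n → ∞`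
(`b^{1/n} → 1`, `a^{1−2/n} → a`, `e^{K/n} → 1`), `L ≤ max(|ω|_∞(t₁), c)` — a contradiction. The VERDICT of record
(#39: first failing step = `Inference50` (50) p.20–21, class false lemma) is untouched. Kernel status of the inputs of
`theorem2_of_steps` after this theorem: Steps 1 `Theorem1`, 3 `Ineq48`, 8 `Part2` TRUE Summits-side
(`SoloSalvageRuzmaikina2008*.lean`), Steps 4 `Ineq49`, 6 `Root51`, 7 `LimitN` TRUE in this file, Step 5 `Inference50`
FALSE (the locator), Steps 2 `Ineq45` and 9 `ImplicitContinuity` undecided (and Steps 10–11 of `claim_of_steps`).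
[cite: Ruzmaikina2008NSVorticityBounds, (52) p.21, (59) p.22] -/
theorem limitN_holds : LimitN := by
  intro ν t₁ t₂ u p hν ht hsol c hc n₂ hyp t htI
  -- ### class facts
  have hS : IsClassicalNSSolutionOn (Icc t₁ t₂) ν 0 u p := hsol.isClassical
  have hsm : ∀ s ∈ Icc t₁ t₂, ContDiff ℝ ∞ (u s) := fun s hs => hS.contDiff_velocity hs
  obtain ⟨R, hRtop, hR⟩ := exists_enorm_curl_le_of_hasBoundedSobolevNormsOn hsm hsol.sobolev
  obtain ⟨C₁, hC₁⟩ := hsol.sobolev 1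
  have ht₁I : t₁ ∈ Icc t₁ t₂ := left_mem_Icc.2 ht.le
  have hcont : ∀ s ∈ Icc t₁ t₂, Continuous (curl (u s)) := fun s hs =>
    continuous_curl ((hsm s hs).of_le (by exact_mod_cast le_top))
  have hEss : ∀ s ∈ Icc t₁ t₂, eLpNormEssSup (curl (u s)) volume ≤ R := fun s hs =>
    eLpNormEssSup_le_of_ae_enorm_bound (Eventually.of_forall (hR s hs))
  have hEssTop : ∀ s ∈ Icc t₁ t₂, eLpNormEssSup (curl (u s)) volume ≠ ⊤ := fun s hs =>
    ((hEss s hs).trans_lt hRtop).ne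
  have hI2 : ∀ s ∈ Icc t₁ t₂, ∫⁻ x, ‖curl (u s) x‖ₑ ^ 2 < ⊤ := fun s hs =>
    lt_of_le_of_lt ((lintegral_curl_sq_le (u s)).trans (mul_le_mul' le_rfl (hC₁ s hs)))
      (ENNReal.mul_lt_top ENNReal.ofReal_lt_top ENNReal.coe_lt_top)
  have hIn : ∀ s ∈ Icc t₁ t₂, ∀ n : ℕ, 2 ≤ n → ∫⁻ x, ‖curl (u s) x‖ₑ ^ n < ⊤ := fun s hs n hn =>
    lt_of_le_of_lt (lintegral_pow_le_essSup_pow_mul _ hn (hEssTop s hs))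
      (ENNReal.mul_lt_top ((ENNReal.pow_ne_top (hEssTop s hs)).lt_top) (hI2 s hs))
  -- `vortNorm ⊤` is the real value of the (finite) essential supremum
  have hTop : ∀ s, vortNorm ⊤ u s = (eLpNormEssSup (curl (u s)) volume).toReal := fun s => by
    unfold vortNorm; rw [eLpNorm_exponent_top]
  -- ### the contradiction hypothesis and the level `L`
  by_contra hcon
  push Not at hcon
  set M : ℝ := max (vortNorm ⊤ u t₁) c with hM
  set e₁ : ℝ := vortNorm ⊤ u t₁ with he₁
  have hM0 : 0 ≤ M := hc.trans (le_max_right _ _)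
  have he₁0 : 0 ≤ e₁ := ENNReal.toReal_nonneg
  set L : ℝ := (M + vortNorm ⊤ u t) / 2 with hL
  have hML : M < L := by rw [hL]; linarith
  have hLt : L < vortNorm ⊤ u t := by rw [hL]; linarith
  have hL0 : 0 < L := lt_of_le_of_lt hM0 hML
  -- ### the superlevel set `{L < |ω(·,t)|}` has positive finite volume
  have hne : ∃ x, L < ‖curl (u t) x‖ := by
    by_contra h
    push Not at h
    have h1 : eLpNormEssSup (curl (u t)) volume ≤ ENNReal.ofReal L :=
      eLpNormEssSup_le_of_ae_bound (Eventually.of_forall h)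
    have h2 : vortNorm ⊤ u t ≤ L := by
      rw [hTop]; exact ENNReal.toReal_le_of_le_ofReal hL0.le h1
    linarith
  set m : ℝ≥0∞ := volume {x | L < ‖curl (u t) x‖} with hm
  have hmpos : 0 < m :=
    (isOpen_lt continuous_const (hcont t htI).norm).measure_pos volume hne
  have hm2 : ENNReal.ofReal L ^ 2 * m ≤ ∫⁻ x, ‖curl (u t) x‖ₑ ^ 2 :=
    pow_mul_measure_le_lintegral_pow (hcont t htI) L 2
  have hmtop : m < ⊤ := by
    have hL2 : ENNReal.ofReal L ^ 2 ≠ 0 := pow_ne_zero _ (by simpa using hL0)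
    exact ENNReal.lt_top_of_mul_ne_top_right (hm2.trans_lt (hI2 t htI)).ne hL2
  set μ : ℝ := m.toReal with hμ
  have hμ0 : 0 < μ := ENNReal.toReal_pos hmpos.ne' hmtop.ne
  -- ### (ii) the lower bound `L · μ^{1/n} ≤ |ω|_n(t)` for `n ≥ 2`
  have hlow : ∀ n : ℕ, 2 ≤ n → L * μ ^ (1 / (n : ℝ)) ≤ vortNorm n u t := by
    intro n hn
    have hn1 : 1 ≤ n := le_trans (by norm_num) hn
    have hn0 : (n : ℝ) ≠ 0 := by exact_mod_cast (Nat.one_le_iff_ne_zero.1 hn1)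
    unfold vortNorm
    rw [toReal_eLpNorm_nat _ hn1]
    have h1 : (ENNReal.ofReal L ^ n * m).toReal ≤ (∫⁻ x, ‖curl (u t) x‖ₑ ^ n).toReal :=
      ENNReal.toReal_mono (hIn t htI n hn).ne (pow_mul_measure_le_lintegral_pow (hcont t htI) L n)
    have h2 : (ENNReal.ofReal L ^ n * m).toReal = L ^ n * μ := by
      rw [ENNReal.toReal_mul, ENNReal.toReal_pow, ENNReal.toReal_ofReal hL0.le]
    rw [h2] at h1
    have h3 : (L ^ n * μ) ^ (1 / (n : ℝ)) = L * μ ^ (1 / (n : ℝ)) := by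
      rw [Real.mul_rpow (pow_nonneg hL0.le n) hμ0.le, one_div, Real.pow_rpow_inv_natCast hL0.le
        (Nat.one_le_iff_ne_zero.1 hn1)]
    rw [← h3]
    exact Real.rpow_le_rpow (mul_nonneg (pow_nonneg hL0.le n) hμ0.le) h1 (by positivity)
  -- ### (i) the upper bound `|ω|_n(t₁) ≤ e₁^{1−2/n} · i₂^{1/n}` for `n ≥ 2`
  set i₂ : ℝ := (∫⁻ x, ‖curl (u t₁) x‖ₑ ^ 2).toReal with hi₂
  have hi₂0 : 0 ≤ i₂ := ENNReal.toReal_nonneg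
  have hup : ∀ n : ℕ, 2 ≤ n →
      vortNorm n u t₁ ≤ e₁ ^ (1 - 2 / (n : ℝ)) * i₂ ^ (1 / (n : ℝ)) := by
    intro n hn
    have hn1 : 1 ≤ n := le_trans (by norm_num) hn
    have hn0 : (n : ℝ) ≠ 0 := by exact_mod_cast (Nat.one_le_iff_ne_zero.1 hn1)
    unfold vortNorm
    rw [toReal_eLpNorm_nat _ hn1]
    have hfin : eLpNormEssSup (curl (u t₁)) volume ^ (n - 2) * ∫⁻ x, ‖curl (u t₁) x‖ₑ ^ 2 ≠ ⊤ :=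
      (ENNReal.mul_lt_top ((ENNReal.pow_ne_top (hEssTop t₁ ht₁I)).lt_top) (hI2 t₁ ht₁I)).ne
    have h1 : (∫⁻ x, ‖curl (u t₁) x‖ₑ ^ n).toReal ≤
        (eLpNormEssSup (curl (u t₁)) volume ^ (n - 2) * ∫⁻ x, ‖curl (u t₁) x‖ₑ ^ 2).toReal :=
      ENNReal.toReal_mono hfin (lintegral_pow_le_essSup_pow_mul _ hn (hEssTop t₁ ht₁I))
    have h2 : (eLpNormEssSup (curl (u t₁)) volume ^ (n - 2) * ∫⁻ x, ‖curl (u t₁) x‖ₑ ^ 2).toReal =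
        e₁ ^ (n - 2) * i₂ := by
      rw [ENNReal.toReal_mul, ENNReal.toReal_pow, he₁, hTop t₁]
    rw [h2] at h1
    have h3 : (e₁ ^ (n - 2) * i₂) ^ (1 / (n : ℝ)) = e₁ ^ (1 - 2 / (n : ℝ)) * i₂ ^ (1 / (n : ℝ)) := by
      rw [Real.mul_rpow (pow_nonneg he₁0 _) hi₂0, ← Real.rpow_natCast e₁ (n - 2),
        ← Real.rpow_mul he₁0]
      congr 2
      rw [Nat.cast_sub hn]
      field_simp
      ring
    rw [← h3]
    exact Real.rpow_le_rpow ENNReal.toReal_nonneg h1 (by positivity)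
  -- ### the limit of the upper envelope
  have hw : ∃ l : ℝ, l ≤ e₁ ∧
      Tendsto (fun n : ℕ => e₁ ^ (1 - 2 / (n : ℝ)) * i₂ ^ (1 / (n : ℝ))) atTop (𝓝 l) := by
    rcases hi₂0.eq_or_lt with hz | hpos
    · refine ⟨0, he₁0, tendsto_const_nhds.congr' ?_⟩
      filter_upwards [eventually_ge_atTop 1] with n hn
      have hn0 : (1 : ℝ) / (n : ℝ) ≠ 0 := one_div_ne_zero (by exact_mod_cast (Nat.one_le_iff_ne_zero.1 hn))
      rw [← hz, Real.zero_rpow hn0, mul_zero]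
    · refine ⟨e₁, le_rfl, ?_⟩
      have := (tendsto_rpow_one_sub_two_div_nat he₁0).mul (tendsto_rpow_one_div_nat hpos)
      rw [mul_one] at this
      exact this
  obtain ⟨l, hle₁, hwl⟩ := hw
  -- ### squeeze and pass to the limit
  set K : ℝ := Real.exp (Real.exp (t₂ - t₁)) with hK
  have hexpK : Tendsto (fun n : ℕ => Real.exp ((1 / (n : ℝ)) * K)) atTop (𝓝 1) := by
    have h1 : Tendsto (fun n : ℕ => (1 / (n : ℝ)) * K) atTop (𝓝 0) := by
      have := (tendsto_one_div_atTop_nhds_zero_nat).mul_const K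
      rw [zero_mul] at this
      exact this
    have h2 := (Real.continuous_exp.tendsto 0).comp h1
    rw [Real.exp_zero] at h2
    exact h2
  have hlhs : Tendsto (fun n : ℕ => L * μ ^ (1 / (n : ℝ))) atTop (𝓝 L) := by
    have := (tendsto_const_nhds (x := L)).mul (tendsto_rpow_one_div_nat hμ0)
    rw [mul_one] at this
    exact this
  have hrhs : Tendsto (fun n : ℕ => Real.exp ((1 / (n : ℝ)) * K) *
      max (e₁ ^ (1 - 2 / (n : ℝ)) * i₂ ^ (1 / (n : ℝ))) c) atTop (𝓝 (1 * max l c)) :=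
    hexpK.mul (hwl.max tendsto_const_nhds)
  have hev : ∀ᶠ n : ℕ in atTop, L * μ ^ (1 / (n : ℝ)) ≤
      Real.exp ((1 / (n : ℝ)) * K) * max (e₁ ^ (1 - 2 / (n : ℝ)) * i₂ ^ (1 / (n : ℝ))) c := by
    filter_upwards [eventually_ge_atTop (max n₂ 2)] with n hn
    have hn₂ : n₂ ≤ n := le_trans (le_max_left _ _) hn
    have hn2 : 2 ≤ n := le_trans (le_max_right _ _) hn
    calc L * μ ^ (1 / (n : ℝ)) ≤ vortNorm n u t := hlow n hn2
      _ ≤ Real.exp ((1 / (n : ℝ)) * K) * max (vortNorm n u t₁) c := hyp n hn₂ t htI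
      _ ≤ Real.exp ((1 / (n : ℝ)) * K) * max (e₁ ^ (1 - 2 / (n : ℝ)) * i₂ ^ (1 / (n : ℝ))) c :=
          mul_le_mul_of_nonneg_left (max_le_max (hup n hn2) le_rfl) (Real.exp_pos _).le
  have hfinal : L ≤ 1 * max l c := le_of_tendsto_of_tendsto hlhs hrhs hev
  have : max l c ≤ M := by rw [hM]; exact max_le_max hle₁ le_rfl
  linarith

/-! ### Kernel certificate (D-0026 debt pass, 2026-08-27): Step 11 `Iteration` is TRUE — restart-and-glue

APPEND-ONLY addition after ADJUDICATED #39 (locator `Inference50`, class false lemma — UNTOUCHED): the iteration of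
the proof of Theorem 3 (pp. 22–23) is discharged in the rendered class from the tree's BKM-class uniqueness and
gluing theorems. Nothing else in this file is edited. -/

/-- Restriction of a class solution to a closed sub-interval of positive length. [folklore] -/
private theorem IsSolutionOn.restrict {ν a b a' b' : ℝ}
    {u : ℝ → EuclideanSpace ℝ (Fin 3) → EuclideanSpace ℝ (Fin 3)} {p : ℝ → EuclideanSpace ℝ (Fin 3) → ℝ}
    (h : IsSolutionOn ν a b u p) (ha : a ≤ a') (hab : a' < b') (hb : b' ≤ b) : IsSolutionOn ν a' b' u p :=
  ⟨h.isClassical.mono (Icc_subset_Icc ha hb) (uniqueDiffOn_Icc hab), h.sobolev.mono (Icc_subset_Icc ha hb)⟩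

/-- Bounded Sobolev norms on `[a, b]` and on `[b', c]`, `b' ≤ b`, give bounded Sobolev norms on `[a, c]` (local copy
of the tree's `HasBoundedSobolevNormsOn.union_Icc`, `TaoSpeedContinuation.lean`, to keep the imports). [folklore] -/
private theorem sobolev_union_Icc {u : ℝ → EuclideanSpace ℝ (Fin 3) → EuclideanSpace ℝ (Fin 3)} {a b b' c : ℝ}
    (h₁ : HasBoundedSobolevNormsOn (Icc a b) u) (h₂ : HasBoundedSobolevNormsOn (Icc b' c) u) (hb : b' ≤ b) :
    HasBoundedSobolevNormsOn (Icc a c) u := fun n => by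
  obtain ⟨C₁, hC₁⟩ := h₁ n
  obtain ⟨C₂, hC₂⟩ := h₂ n
  refine ⟨max C₁ C₂, fun t ht => ?_⟩
  rcases le_or_gt t b with htb | htb
  · exact (hC₁ t ⟨ht.1, htb⟩).trans (ENNReal.coe_le_coe.2 (le_max_left _ _))
  · exact (hC₂ t ⟨hb.trans htb.le, ht.2⟩).trans (ENNReal.coe_le_coe.2 (le_max_right _ _))

/-- Time translation of the strong class (local copy of the tree's `HasBoundedSobolevNormsOn.comp_add_right`).
[folklore] -/
private theorem sobolev_comp_add_right {u : ℝ → EuclideanSpace ℝ (Fin 3) → EuclideanSpace ℝ (Fin 3)} {a b : ℝ}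
    (s : ℝ) (h : HasBoundedSobolevNormsOn (Icc (a + s) (b + s)) u) :
    HasBoundedSobolevNormsOn (Icc a b) (fun t => u (t + s)) := fun n =>
  (h n).imp fun _ hC t ht => hC (t + s) ⟨by linarith [ht.1], by linarith [ht.2]⟩

/-- Transfer of the strong class along equality of slices (local copy of the tree's
`HasBoundedSobolevNormsOn.congr`). [folklore] -/
private theorem sobolev_congr {u v : ℝ → EuclideanSpace ℝ (Fin 3) → EuclideanSpace ℝ (Fin 3)} {S : Set ℝ}
    (h : HasBoundedSobolevNormsOn S v) (heq : ∀ t ∈ S, u t = v t) : HasBoundedSobolevNormsOn S u := fun n =>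
  (h n).imp fun _ hC t ht => by
    rw [heq t ht]
    exact hC t ht

/-- A continuous field is pointwise bounded by its (finite) essential supremum: the open superlevel set
`{‖f‖ > L}`, `ess sup < L`, is a null open set, hence empty (Lebesgue measure charges open sets). [folklore] -/
private theorem norm_le_toReal_eLpNormEssSup {f : EuclideanSpace ℝ (Fin 3) → EuclideanSpace ℝ (Fin 3)}
    (hf : Continuous f) (hE : eLpNormEssSup f volume ≠ ⊤) (x : EuclideanSpace ℝ (Fin 3)) :
    ‖f x‖ ≤ (eLpNormEssSup f volume).toReal := by
  by_contra h
  push Not at h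
  set e : ℝ := (eLpNormEssSup f volume).toReal with he
  set L : ℝ := (e + ‖f x‖) / 2 with hL
  have hLe : e < L := by rw [hL]; linarith
  have hLx : L < ‖f x‖ := by rw [hL]; linarith
  have hU : IsOpen {y | L < ‖f y‖} := isOpen_lt continuous_const hf.norm
  have hpos : 0 < volume {y | L < ‖f y‖} := hU.measure_pos volume ⟨x, hLx⟩
  have hzero : volume {y | L < ‖f y‖} = 0 := by
    rw [measure_eq_zero_iff_ae_notMem]
    filter_upwards [ae_le_eLpNormEssSup (μ := volume) (f := f)] with y hy
    simp only [not_lt]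
    have h1 : ‖f y‖ ≤ e := by
      rw [← ofReal_norm] at hy
      exact (ENNReal.ofReal_le_iff_le_toReal hE).1 hy
    linarith
  exact hpos.ne' hzero

/-- A datum of the class has bounded vorticity: `‖∇ × u₀‖ ≤ R < ∞` pointwise (Sobolev imbedding, tree
`exists_enorm_curl_le_of_hasBoundedSobolevNormsOn` on the constant family). [folklore] -/
private theorem exists_curl_bound_of_isDatum {u₀ : EuclideanSpace ℝ (Fin 3) → EuclideanSpace ℝ (Fin 3)}
    (h : IsDatum u₀) : ∃ R : ℝ≥0∞, R < ⊤ ∧ ∀ x, ‖curl u₀ x‖ₑ ≤ R := by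
  have hB : HasBoundedSobolevNormsOn (univ : Set ℝ) (fun _ : ℝ => u₀) := fun n =>
    ⟨(∫⁻ x, ‖iteratedFDeriv ℝ n u₀ x‖ₑ ^ 2).toNNReal, fun t _ => by
      rw [ENNReal.coe_toNNReal (h.2.2 n).ne]⟩
  obtain ⟨R, hR, hb⟩ := exists_enorm_curl_le_of_hasBoundedSobolevNormsOn (fun _ _ => h.1) hB
  exact ⟨R, hR, fun x => hb 0 (mem_univ _) x⟩

/-- Along a class solution on `[0, b]` the vorticity stays pointwise below `max(R, e^e)` whenever the a priori
bound (59) is available and `‖∇ × u(0)‖ ≤ R` (essentially). [folklore] -/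
private theorem curl_le_of_apriori {ν b : ℝ} {u : ℝ → EuclideanSpace ℝ (Fin 3) → EuclideanSpace ℝ (Fin 3)}
    {p : ℝ → EuclideanSpace ℝ (Fin 3) → ℝ} (hapr : AprioriBound59 ν) (hb : 0 < b) (hsol : IsSolutionOn ν 0 b u p)
    {R : ℝ≥0∞} (hRtop : R < ⊤) (hR : ∀ x, ‖curl (u 0) x‖ₑ ≤ R) {τ : ℝ} (hτ : τ ∈ Icc 0 b)
    (x : EuclideanSpace ℝ (Fin 3)) : ‖curl (u τ) x‖ ≤ max R.toReal (Real.exp (Real.exp 1)) := by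
  have hsm : ∀ s ∈ Icc 0 b, ContDiff ℝ ∞ (u s) := fun s hs => hsol.isClassical.contDiff_velocity hs
  obtain ⟨R', hR'top, hR'⟩ := exists_enorm_curl_le_of_hasBoundedSobolevNormsOn hsm hsol.sobolev
  have hEτ : eLpNormEssSup (curl (u τ)) volume ≠ ⊤ :=
    ((eLpNormEssSup_le_of_ae_enorm_bound (Eventually.of_forall (hR' τ hτ))).trans_lt hR'top).ne
  have hcont : Continuous (curl (u τ)) := continuous_curl ((hsm τ hτ).of_le (by exact_mod_cast le_top))
  have h1 : ‖curl (u τ) x‖ ≤ vortNorm ⊤ u τ := by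
    unfold vortNorm; rw [eLpNorm_exponent_top]; exact norm_le_toReal_eLpNormEssSup hcont hEτ x
  have h2 : vortNorm ⊤ u τ ≤ max (vortNorm ⊤ u 0) (Real.exp (Real.exp 1)) := hapr 0 b u p hb hsol τ hτ
  have h3 : vortNorm ⊤ u 0 ≤ R.toReal := by
    unfold vortNorm; rw [eLpNorm_exponent_top]
    exact ENNReal.toReal_mono hRtop.ne (eLpNormEssSup_le_of_ae_enorm_bound (Eventually.of_forall hR))
  exact h1.trans (h2.trans (max_le_max h3 le_rfl))

/-- **The restart-and-glue step.** From a class solution `(u, p)` on `[0, b]` with `u 0 = u₀` and `h/2 ≤ b`, a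
local class solution of length `h` launched from the slice at `τ = b − h/2` (the paper's [Ku] step), BKM-class
uniqueness on the overlap `[τ, b]` (tree `IsClassicalNSSolutionOn.eq_of_hasBoundedSobolevNormsOn`, after
translating by `τ`) and the open-overlap gluing of classical solutions (tree `IsClassicalNSSolutionOn.glue`, which
renormalises the pressures) produce a class solution on `[0, b + h/4]` with the same data. [folklore] -/
private theorem extend_step {ν h M b : ℝ} (hν : 0 < ν) (hh0 : 0 < h)
    (hstep : ∀ (τ : ℝ) (v : EuclideanSpace ℝ (Fin 3) → EuclideanSpace ℝ (Fin 3)), IsDatum v →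
      (∀ x, ‖curl v x‖ ≤ M) →
      ∃ (w : ℝ → EuclideanSpace ℝ (Fin 3) → EuclideanSpace ℝ (Fin 3)) (q : ℝ → EuclideanSpace ℝ (Fin 3) → ℝ),
        IsSolutionOn ν τ (τ + h) w q ∧ w τ = v)
    {u₀ : EuclideanSpace ℝ (Fin 3) → EuclideanSpace ℝ (Fin 3)}
    {u : ℝ → EuclideanSpace ℝ (Fin 3) → EuclideanSpace ℝ (Fin 3)} {p : ℝ → EuclideanSpace ℝ (Fin 3) → ℝ}
    (hsol : IsSolutionOn ν 0 b u p) (hu0 : u 0 = u₀) (hhb : h / 2 ≤ b)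
    (hcurl : ∀ τ ∈ Icc 0 b, ∀ x, ‖curl (u τ) x‖ ≤ M) :
    ∃ (u' : ℝ → EuclideanSpace ℝ (Fin 3) → EuclideanSpace ℝ (Fin 3)) (p' : ℝ → EuclideanSpace ℝ (Fin 3) → ℝ),
      IsSolutionOn ν 0 (b + h / 4) u' p' ∧ u' 0 = u₀ := by
  set τ : ℝ := b - h / 2 with hτ
  have hτ0 : 0 ≤ τ := by rw [hτ]; linarith
  have hτb : τ < b := by rw [hτ]; linarith
  have hτI : τ ∈ Icc 0 b := ⟨hτ0, hτb.le⟩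
  have hb0 : 0 < b := lt_of_le_of_lt hτ0 hτb
  -- the local piece from the slice at `τ`
  obtain ⟨w, q, hw, hwτ⟩ := hstep τ (u τ) (isDatum_slice hsol hτI) (hcurl τ hτI)
  have hτh : τ + h = b + h / 2 := by rw [hτ]; ring
  -- ### uniqueness on the overlap `[τ, b]`, after translation by `τ`
  have hδ : 0 < b - τ := sub_pos.2 hτb
  have hU₁ : IsClassicalNSSolutionOn (Icc 0 (b - τ)) ν 0 (fun t => u (t + τ)) (fun t => p (t + τ)) := by
    have h1 := (hsol.isClassical.comp_add_right τ).mono (S' := Icc 0 (b - τ)) (fun t ht =>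
      ⟨by simp only [mem_Icc] at ht; linarith [ht.1], by simp only [mem_Icc] at ht; linarith [ht.2]⟩)
      (uniqueDiffOn_Icc hδ)
    exact h1
  have hU₂ : IsClassicalNSSolutionOn (Icc 0 (b - τ)) ν 0 (fun t => w (t + τ)) (fun t => q (t + τ)) := by
    have h1 := (hw.isClassical.comp_add_right τ).mono (S' := Icc 0 (b - τ)) (fun t ht =>
      ⟨by simp only [mem_Icc] at ht; linarith [ht.1], by simp only [mem_Icc] at ht; linarith [ht.2]⟩)
      (uniqueDiffOn_Icc hδ)
    exact h1
  have hB₁ : HasBoundedSobolevNormsOn (Icc 0 (b - τ)) (fun t => u (t + τ)) :=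
    sobolev_comp_add_right τ
      (hsol.sobolev.mono (Icc_subset_Icc (by linarith) (by linarith)))
  have hB₂ : HasBoundedSobolevNormsOn (Icc 0 (b - τ)) (fun t => w (t + τ)) :=
    sobolev_comp_add_right τ
      (hw.sobolev.mono (Icc_subset_Icc (by linarith) (by linarith)))
  have heq : ∀ t ∈ Icc τ b, u t = w t := by
    intro t ht
    have h0 : (fun t => u (t + τ)) 0 = (fun t => w (t + τ)) 0 := by simp [hwτ]
    have := IsClassicalNSSolutionOn.eq_of_hasBoundedSobolevNormsOn hU₁ hU₂ hν.le hδ hB₁ hB₂ h0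
      (t := t - τ) ⟨by linarith [ht.1], by linarith [ht.2]⟩
    simpa using this
  -- ### gluing along the open overlap `(τ, b)`
  have hg₁ : IsClassicalNSSolutionOn (Ico 0 b) ν 0 u p :=
    hsol.isClassical.mono Ico_subset_Icc_self (uniqueDiffOn_Ico 0 b)
  have hg₂ : IsClassicalNSSolutionOn (Ioo τ (τ + h)) ν 0 w q :=
    hw.isClassical.mono Ioo_subset_Icc_self (uniqueDiffOn_Ioo τ (τ + h))
  have hglue := IsClassicalNSSolutionOn.glue hg₁ hg₂ hτ0 hτb (by linarith) fun t ht => heq t ⟨ht.1.le, ht.2.le⟩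
  set u' : ℝ → EuclideanSpace ℝ (Fin 3) → EuclideanSpace ℝ (Fin 3) := fun t => if t < b then u t else w t
    with hu'
  set p' : ℝ → EuclideanSpace ℝ (Fin 3) → ℝ :=
    fun t => if t < b then (fun x => p t x - p t 0) else fun x => q t x - q t 0 with hp'
  have hb' : b + h / 4 < τ + h := by rw [hτ]; linarith
  have hb'0 : 0 < b + h / 4 := by linarith
  refine ⟨u', p', ⟨hglue.mono (Icc_subset_Ico_right hb') (uniqueDiffOn_Icc hb'0), ?_⟩, ?_⟩
  · -- Sobolev bounds of the glued velocity on `[0, b + h/4]`: those of `u` on `[0, b]` and of `w` on `[τ, b + h/4]`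
    have hw1 : HasBoundedSobolevNormsOn (Icc 0 b) u' := by
      refine sobolev_congr hsol.sobolev fun t ht => ?_
      simp only [hu']
      split_ifs with htb
      · rfl
      · have htb' : t = b := le_antisymm ht.2 (not_lt.1 htb)
        rw [htb']
        exact (heq b ⟨hτb.le, le_rfl⟩).symm
    have hw2 : HasBoundedSobolevNormsOn (Icc τ (b + h / 4)) u' := by
      refine sobolev_congr (hw.sobolev.mono (Icc_subset_Icc le_rfl hb'.le)) fun t ht => ?_
      simp only [hu']
      split_ifs with htb
      · exact heq t ⟨ht.1, htb.le⟩
      · rfl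
    exact sobolev_union_Icc hw1 hw2 hτb.le
  · simp only [hu', if_pos hb0, hu0]

/-- **Step 11 `Iteration` HOLDS** (pp. 22–23 up to (61): «Repeating this argument `k` times … For any `T > 0`, we
can continue this argument up to `k` such that `k ≥ T/t₀'`»; the typist's flag «True, classical: restart-and-glue»
made a kernel fact). With `R` a pointwise bound of `∇ × u₀` (Sobolev imbedding on the datum), `M = max(R, e^e)` and
the [Ku] step length `h = ν/(2CM²)`: the first piece lives on `[0, h]`; along any class solution from `u₀` the a
priori bound (59) and `|ω|_∞(0) ≤ R` keep `‖∇ × u(τ)‖ ≤ M` pointwise at every time (continuity: ess sup bounds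
continuous functions everywhere), so the local step restarts from every slice with the SAME length `h`; restarting
at `τ = b − h/2` (an overlap is needed to glue classical solutions smoothly — uniqueness in the class is the tree's
`IsClassicalNSSolutionOn.eq_of_hasBoundedSobolevNormsOn`, Majda–Bertozzi Cor. 3.1) extends `[0, b]` to
`[0, b + h/4]` (`extend_step`); `⌈4T/h⌉` restarts reach `T`. The VERDICT of record (#39: locator `Inference50`,
false lemma) is untouched; of the eleven inputs of `claim_of_steps` only Steps 2 `Ineq45`, 9 `ImplicitContinuity`,
10 `KuLocal` remain undecided (Step 5 the kernel-false locator; Steps 1, 3, 8 TRUE Summits-side; 4, 6, 7, 11 TRUE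
here). [cite: Ruzmaikina2008NSVorticityBounds, Proof of Theorem 3 pp.22–23, (61)] -/
theorem iteration_holds : Iteration := by
  intro C ν hC hν hloc hapr u₀ hu₀ T hT
  -- ### the uniform vorticity bound `M` and the step length `h`
  obtain ⟨R, hRtop, hR⟩ := exists_curl_bound_of_isDatum hu₀
  set M : ℝ := max R.toReal (Real.exp (Real.exp 1)) with hM
  have hM0 : 0 < M := lt_of_lt_of_le (Real.exp_pos _) (le_max_right _ _)
  set h : ℝ := ν / (2 * C * M ^ 2) with hh
  have hh0 : 0 < h := by rw [hh]; positivity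
  have hstep : ∀ (τ : ℝ) (v : EuclideanSpace ℝ (Fin 3) → EuclideanSpace ℝ (Fin 3)), IsDatum v →
      (∀ x, ‖curl v x‖ ≤ M) →
      ∃ (w : ℝ → EuclideanSpace ℝ (Fin 3) → EuclideanSpace ℝ (Fin 3)) (q : ℝ → EuclideanSpace ℝ (Fin 3) → ℝ),
        IsSolutionOn ν τ (τ + h) w q ∧ w τ = v :=
    fun τ v hv hb => hloc τ M v hM0 hv hb
  have hcurl0 : ∀ x, ‖curl u₀ x‖ ≤ M := fun x => by
    have h1 : ‖curl u₀ x‖ ≤ R.toReal := by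
      rw [← ENNReal.ofReal_le_iff_le_toReal hRtop.ne, ofReal_norm]; exact hR x
    exact h1.trans (le_max_left _ _)
  -- ### induction on the number of restarts: a class solution on `[0, h + k h/4]`
  have P : ∀ k : ℕ, ∃ (u : ℝ → EuclideanSpace ℝ (Fin 3) → EuclideanSpace ℝ (Fin 3))
      (p : ℝ → EuclideanSpace ℝ (Fin 3) → ℝ), IsSolutionOn ν 0 (h + k * (h / 4)) u p ∧ u 0 = u₀ := by
    intro k
    induction k with
    | zero =>
      obtain ⟨w, q, hw, hw0⟩ := hstep 0 u₀ hu₀ hcurl0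
      refine ⟨w, q, ?_, hw0⟩
      simpa using hw
    | succ k ih =>
      obtain ⟨u, p, hsol, hu0⟩ := ih
      have hb : h / 2 ≤ h + k * (h / 4) := by
        have : (0 : ℝ) ≤ k * (h / 4) := by positivity
        linarith
      have hb0 : 0 < h + k * (h / 4) := lt_of_lt_of_le (by linarith) hb
      have hcurl : ∀ τ ∈ Icc 0 (h + k * (h / 4)), ∀ x, ‖curl (u τ) x‖ ≤ M := by
        intro τ hτ x
        have hR0 : ∀ x, ‖curl (u 0) x‖ₑ ≤ R := fun x => by rw [hu0]; exact hR x
        exact curl_le_of_apriori hapr hb0 hsol hRtop hR0 hτ x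
      obtain ⟨u', p', hsol', hu0'⟩ := extend_step hν hh0 hstep hsol hu0 hb hcurl
      refine ⟨u', p', ?_, hu0'⟩
      have : h + (k : ℝ) * (h / 4) + h / 4 = h + ((k + 1 : ℕ) : ℝ) * (h / 4) := by push_cast; ring
      rw [← this]
      exact hsol'
  -- ### reach `T`
  obtain ⟨k, hk⟩ : ∃ k : ℕ, T ≤ h + k * (h / 4) := by
    obtain ⟨k, hk⟩ := exists_nat_ge (T / (h / 4))
    refine ⟨k, ?_⟩
    have h4 : 0 < h / 4 := by linarith
    have : T ≤ k * (h / 4) := by rwa [div_le_iff₀ h4] at hk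
    linarith
  obtain ⟨u, p, hsol, hu0⟩ := P k
  exact ⟨u, p, ⟨hsol.restrict le_rfl hT hk, hu0⟩⟩

/-! ### Kernel certificate (D-0026 debt pass, 2026-08-27): Step 9 `ImplicitContinuity` is TRUE — `t ↦ |ω|_n(t)` is
continuous in the class

APPEND-ONLY addition after ADJUDICATED #39 (locator `Inference50`, class false lemma — UNTOUCHED): the continuity
hypothesis of Theorem 2's dichotomy, ASSUMED in print (p. 22 / p. 23), is discharged in the rendered class: the curl of
the momentum equation bounds `∂ₜω` in `L²` uniformly on the slab, the fundamental theorem of calculus + Cauchy–Schwarz +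
Tonelli give `L²`-Lipschitz continuity of `t ↦ ω(t)`, and the uniform `L^∞` bound of the class interpolates to every
`Lⁿ`, `n ≥ 2`. Nothing else in this file is edited. -/

/-- `∂ₜ ω = curl (∂ₜ u)` along every time line, as a one-sided derivative within a time set
`S ⊆ closure (interior S)` of unique differentiability (mixed partials commute,
`IsSmoothSpaceTimeOn.timeDerivWithin_fderiv_slice_apply`). [folklore] -/
private theorem hasDerivWithinAt_curl_slice {S : Set ℝ}
    {u : ℝ → EuclideanSpace ℝ (Fin 3) → EuclideanSpace ℝ (Fin 3)} (h : IsSmoothSpaceTimeOn S u)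
    (hS : UniqueDiffOn ℝ S) (hcl : S ⊆ closure (interior S)) {t : ℝ} (ht : t ∈ S)
    (x : EuclideanSpace ℝ (Fin 3)) :
    HasDerivWithinAt (fun s => curl (u s) x) (curl (timeDerivWithin S u t) x) S t := by
  have hD : HasDerivWithinAt (fun s => fderiv ℝ (u s) x)
      (timeDerivWithin S (fun s y => fderiv ℝ (u s) y) t x) S t :=
    (h.fderiv_slice hS).hasDerivWithinAt_timeDerivWithin hS ht x
  have hEq : timeDerivWithin S (fun s y => fderiv ℝ (u s) y) t x = fderiv ℝ (timeDerivWithin S u t) x := by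
    refine ContinuousLinearMap.ext fun w => ?_
    have h1 := h.timeDerivWithin_fderiv_slice_apply hS hcl ht x w
    rw [← h1]
    have h2 := ((ContinuousLinearMap.apply ℝ (EuclideanSpace ℝ (Fin 3)) w).hasFDerivAt.comp_hasDerivWithinAt
      t hD).derivWithin (hS t ht)
    simp only [ContinuousLinearMap.apply_apply] at h2
    rw [← h2]
    rfl
  have hcomp : HasDerivWithinAt (fun s => curlCLM (fderiv ℝ (u s) x))
      (curlCLM (timeDerivWithin S (fun s y => fderiv ℝ (u s) y) t x)) S t :=
    curlCLM.hasFDerivAt.comp_hasDerivWithinAt t hD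
  rw [hEq] at hcomp
  exact hcomp

/-- Uniform sup bound of the velocity in the class (Sobolev imbedding `W^{2,2}(ℝ³) ⊂ C_B`,
orders `0, 1, 2`). [folklore] -/
private theorem exists_enorm_le_of_sobolev {S : Set ℝ}
    {u : ℝ → EuclideanSpace ℝ (Fin 3) → EuclideanSpace ℝ (Fin 3)}
    (hu : ∀ t ∈ S, ContDiff ℝ ∞ (u t)) (hB : HasBoundedSobolevNormsOn S u) :
    ∃ U : ℝ≥0∞, U < ⊤ ∧ ∀ t ∈ S, ∀ x, ‖u t x‖ₑ ≤ U := by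
  obtain ⟨K, hK, hbound⟩ :=
    Literature.Analysis.FunctionSpaces.exists_enorm_le_sobolev_two_two_dim_three
      (E := EuclideanSpace ℝ (Fin 3)) (F := EuclideanSpace ℝ (Fin 3))
      (volume : Measure (EuclideanSpace ℝ (Fin 3))) finrank_euclideanSpace_fin
  choose C hC using hB
  refine ⟨K * ∑ j ∈ Finset.range 3, ((C j : ℝ≥0∞) ^ (1 / 2 : ℝ)), ?_, fun t ht x => ?_⟩
  · refine ENNReal.mul_lt_top hK (ENNReal.sum_lt_top.2 fun j _ => ?_)
    exact ENNReal.rpow_lt_top_of_nonneg (by norm_num) ENNReal.coe_ne_top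
  · have hg : ContDiff ℝ 2 (u t) := (hu t ht).of_le (by norm_cast)
    refine (hbound _ hg x).trans ?_
    gcongr with j _
    exact eLpNorm_two_le_rpow_of_lintegral_sq_le (hC j t ht)

/-- `‖v‖ ≤ U.toReal` from `‖v‖ₑ ≤ U < ∞`. [folklore] -/
private theorem norm_le_toReal_of_enorm_le {F : Type*} [NormedAddCommGroup F] {v : F} {U : ℝ≥0∞}
    (hU : U ≠ ⊤) (h : ‖v‖ₑ ≤ U) : ‖v‖ ≤ U.toReal :=
  (ENNReal.ofReal_le_iff_le_toReal hU).1 (by rwa [ofReal_norm])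

/-- `‖D(curl w)(x)‖ ≤ ‖curlCLM‖ ‖D²w(x)‖`. [folklore] -/
private theorem norm_fderiv_curl_le {w : EuclideanSpace ℝ (Fin 3) → EuclideanSpace ℝ (Fin 3)}
    (hw : ContDiff ℝ 2 w) (x : EuclideanSpace ℝ (Fin 3)) :
    ‖fderiv ℝ (curl w) x‖ ≤ ‖curlCLM‖ * ‖iteratedFDeriv ℝ 2 w x‖ := by
  have hD : ContDiff ℝ 1 (fderiv ℝ w) := hw.fderiv_right (m := 1) (by norm_cast)
  have h1 : ‖fderiv ℝ (curl w) x‖ = ‖iteratedFDeriv ℝ 1 (curl w) x‖ := by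
    rw [← norm_iteratedFDeriv_fderiv, norm_iteratedFDeriv_zero]
  rw [h1, curl_eq_curlCLM_comp, ContinuousLinearMap.iteratedFDeriv_comp_left curlCLM hD.contDiffAt
    le_rfl, ← norm_iteratedFDeriv_fderiv]
  exact ContinuousLinearMap.norm_compContinuousMultilinearMap_le _ _

/-- `3 · (c² ∫‖h‖ₑ²) = ∫ 3 c² ‖h‖ₑ²`. [folklore] -/
private theorem three_mul_lintegral_eq {H : Type*} [NormedAddCommGroup H]
    (h : EuclideanSpace ℝ (Fin 3) → H) (c : ℝ) :
    3 * (ENNReal.ofReal (c ^ 2) * ∫⁻ x, ‖h x‖ₑ ^ 2) =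
      ∫⁻ x, 3 * (ENNReal.ofReal (c ^ 2) * ‖h x‖ₑ ^ 2) := by
  rw [← lintegral_const_mul' _ _ ENNReal.ofReal_ne_top, ← lintegral_const_mul' _ _ (by norm_num)]

/-- `ofReal (3 c² ‖v‖²) = 3 · ofReal c² · ‖v‖ₑ²`. [folklore] -/
private theorem ofReal_three_mul_sq {H : Type*} [NormedAddCommGroup H] (v : H) (c : ℝ) :
    ENNReal.ofReal (3 * (c ^ 2 * ‖v‖ ^ 2)) = 3 * (ENNReal.ofReal (c ^ 2) * ‖v‖ₑ ^ 2) := by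
  rw [ENNReal.ofReal_mul (by norm_num), ENNReal.ofReal_mul (sq_nonneg _), ← ofReal_norm,
    ENNReal.ofReal_pow (norm_nonneg _), ENNReal.ofReal_ofNat]

/-- Three-term pointwise-to-integral bound: `‖g‖ ≤ c₁‖h₁‖ + c₂‖h₂‖ + c₃‖h₃‖` pointwise gives
`∫‖g‖ₑ² ≤ 3(c₁² ∫‖h₁‖ₑ² + c₂² ∫‖h₂‖ₑ² + c₃² ∫‖h₃‖ₑ²)`. [folklore] -/
private theorem lintegral_enorm_sq_le_three {G H₁ H₂ H₃ : Type*} [NormedAddCommGroup G]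
    [NormedAddCommGroup H₁] [NormedAddCommGroup H₂] [NormedAddCommGroup H₃]
    {g : EuclideanSpace ℝ (Fin 3) → G} {h₁ : EuclideanSpace ℝ (Fin 3) → H₁}
    {h₂ : EuclideanSpace ℝ (Fin 3) → H₂} {h₃ : EuclideanSpace ℝ (Fin 3) → H₃} {c₁ c₂ c₃ : ℝ}
    (hm₂ : Measurable fun x => ‖h₂ x‖ₑ) (hm₃ : Measurable fun x => ‖h₃ x‖ₑ)
    (hle : ∀ x, ‖g x‖ ≤ c₁ * ‖h₁ x‖ + c₂ * ‖h₂ x‖ + c₃ * ‖h₃ x‖) :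
    ∫⁻ x, ‖g x‖ₑ ^ 2 ≤ 3 * (ENNReal.ofReal (c₁ ^ 2) * ∫⁻ x, ‖h₁ x‖ₑ ^ 2) +
      3 * (ENNReal.ofReal (c₂ ^ 2) * ∫⁻ x, ‖h₂ x‖ₑ ^ 2) +
      3 * (ENNReal.ofReal (c₃ ^ 2) * ∫⁻ x, ‖h₃ x‖ₑ ^ 2) := by
  rw [three_mul_lintegral_eq h₁ c₁, three_mul_lintegral_eq h₂ c₂, three_mul_lintegral_eq h₃ c₃,
    ← lintegral_add_right', ← lintegral_add_right']
  rotate_left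
  · exact ((hm₃.pow_const 2).const_mul _).const_mul _ |>.aemeasurable
  · exact ((hm₂.pow_const 2).const_mul _).const_mul _ |>.aemeasurable
  refine lintegral_mono fun x => ?_
  have key : ‖g x‖ ^ 2 ≤ 3 * (c₁ ^ 2 * ‖h₁ x‖ ^ 2) + 3 * (c₂ ^ 2 * ‖h₂ x‖ ^ 2) +
      3 * (c₃ ^ 2 * ‖h₃ x‖ ^ 2) := by
    have h0 := hle x
    have hg0 := norm_nonneg (g x)
    nlinarith [sq_nonneg (c₁ * ‖h₁ x‖ - c₂ * ‖h₂ x‖), sq_nonneg (c₂ * ‖h₂ x‖ - c₃ * ‖h₃ x‖),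
      sq_nonneg (c₁ * ‖h₁ x‖ - c₃ * ‖h₃ x‖), mul_self_le_mul_self hg0 h0]
  calc ‖g x‖ₑ ^ 2 = ENNReal.ofReal (‖g x‖ ^ 2) := by
        rw [← ofReal_norm, ENNReal.ofReal_pow (norm_nonneg _)]
    _ ≤ ENNReal.ofReal (3 * (c₁ ^ 2 * ‖h₁ x‖ ^ 2) + 3 * (c₂ ^ 2 * ‖h₂ x‖ ^ 2) +
          3 * (c₃ ^ 2 * ‖h₃ x‖ ^ 2)) := ENNReal.ofReal_le_ofReal key
    _ = _ := by
        rw [ENNReal.ofReal_add (by positivity) (by positivity),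
          ENNReal.ofReal_add (by positivity) (by positivity), ofReal_three_mul_sq,
          ofReal_three_mul_sq, ofReal_three_mul_sq]

/-- **`sup_τ ∫ |curl ∂ₜu(τ)|² < ∞` in the class.** The curl of the momentum equation
(`IsClassicalNSSolutionOn.curl_timeDerivWithin_eq`: `curl ∂ₜu = νΔω − (u·∇)ω + (ω·∇)u`, the
pressure gradient being curl free) is bounded pointwise by
`3|ν|κ‖D³u‖ + κ(sup|u|)‖D²u‖ + (sup|ω|)‖Du‖`, whose squares are integrable uniformly on the slab by
the Sobolev bounds of orders `1, 2, 3` (sup bounds by the imbedding `W^{2,2} ⊂ C_B`). [folklore] -/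
private theorem exists_lintegral_curl_timeDerivWithin_sq_le {ν a b : ℝ}
    {u : ℝ → EuclideanSpace ℝ (Fin 3) → EuclideanSpace ℝ (Fin 3)}
    {p : ℝ → EuclideanSpace ℝ (Fin 3) → ℝ} (hsol : IsSolutionOn ν a b u p) (hab : a < b) :
    ∃ Λ : ℝ≥0∞, Λ ≠ ⊤ ∧
      ∀ τ ∈ Icc a b, ∫⁻ x, ‖curl (timeDerivWithin (Icc a b) u τ) x‖ₑ ^ 2 ≤ Λ := by
  have hS : IsClassicalNSSolutionOn (Icc a b) ν 0 u p := hsol.isClassical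
  have hU : UniqueDiffOn ℝ (Icc a b) := uniqueDiffOn_Icc hab
  have hsm : ∀ s ∈ Icc a b, ContDiff ℝ ∞ (u s) := fun s hs => hS.contDiff_velocity hs
  obtain ⟨R, hRtop, hR⟩ := exists_enorm_curl_le_of_hasBoundedSobolevNormsOn hsm hsol.sobolev
  obtain ⟨U₀, hU₀top, hU₀⟩ := exists_enorm_le_of_sobolev hsm hsol.sobolev
  choose C hC using hsol.sobolev
  set κ : ℝ := ‖curlCLM‖ with hκ
  set c₁ : ℝ := |ν| * (3 * κ) with hc₁
  set c₂ : ℝ := κ * U₀.toReal with hc₂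
  set c₃ : ℝ := R.toReal with hc₃
  refine ⟨3 * (ENNReal.ofReal (c₁ ^ 2) * C 3) + 3 * (ENNReal.ofReal (c₂ ^ 2) * C 2) +
      3 * (ENNReal.ofReal (c₃ ^ 2) * C 1), ?_, fun τ hτ => ?_⟩
  · have h3 : (3 : ℝ≥0∞) ≠ ⊤ := ENNReal.ofNat_ne_top
    exact ENNReal.add_ne_top.2 ⟨ENNReal.add_ne_top.2
      ⟨ENNReal.mul_ne_top h3 (ENNReal.mul_ne_top ENNReal.ofReal_ne_top ENNReal.coe_ne_top),
       ENNReal.mul_ne_top h3 (ENNReal.mul_ne_top ENNReal.ofReal_ne_top ENNReal.coe_ne_top)⟩,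
      ENNReal.mul_ne_top h3 (ENNReal.mul_ne_top ENNReal.ofReal_ne_top ENNReal.coe_ne_top)⟩
  · have hu : ContDiff ℝ ∞ (u τ) := hsm τ hτ
    have hu2 : ContDiff ℝ 2 (u τ) := hu.of_le (by norm_cast)
    have hu3 : ContDiff ℝ 3 (u τ) := hu.of_le (by norm_cast)
    have hcu2 : ContDiff ℝ 2 (curl (u τ)) := contDiff_curl (n := 2) (hu.of_le (by norm_cast))
    have hpt : ∀ x, ‖curl (timeDerivWithin (Icc a b) u τ) x‖ ≤
        c₁ * ‖iteratedFDeriv ℝ 3 (u τ) x‖ + c₂ * ‖iteratedFDeriv ℝ 2 (u τ) x‖ +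
          c₃ * ‖iteratedFDeriv ℝ 1 (u τ) x‖ := by
      intro x
      rw [hS.curl_timeDerivWithin_eq hU hτ x]
      have e0 : curl ((0 : ℝ → EuclideanSpace ℝ (Fin 3) → EuclideanSpace ℝ (Fin 3)) τ) x = 0 :=
        curl_zero x
      have t1 : ‖ν • (Laplacian.laplacian (curl (u τ))) x‖ ≤ c₁ * ‖iteratedFDeriv ℝ 3 (u τ) x‖ := by
        rw [norm_smul, Real.norm_eq_abs]
        calc |ν| * ‖(Laplacian.laplacian (curl (u τ))) x‖
            ≤ |ν| * (3 * ‖iteratedFDeriv ℝ 2 (curl (u τ)) x‖) :=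
              mul_le_mul_of_nonneg_left (norm_laplacian_le_three_mul_norm_iteratedFDeriv_two hcu2 x)
                (abs_nonneg ν)
          _ ≤ |ν| * (3 * (κ * ‖iteratedFDeriv ℝ 3 (u τ) x‖)) := by
              gcongr; exact norm_iteratedFDeriv_two_curl_le hu3 x
          _ = c₁ * ‖iteratedFDeriv ℝ 3 (u τ) x‖ := by rw [hc₁]; ring
      have t2 : ‖convect (u τ) (curl (u τ)) x‖ ≤ c₂ * ‖iteratedFDeriv ℝ 2 (u τ) x‖ := by
        rw [convect_apply]
        calc ‖fderiv ℝ (curl (u τ)) x (u τ x)‖ ≤ ‖fderiv ℝ (curl (u τ)) x‖ * ‖u τ x‖ :=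
              ContinuousLinearMap.le_opNorm _ _
          _ ≤ (κ * ‖iteratedFDeriv ℝ 2 (u τ) x‖) * U₀.toReal :=
              mul_le_mul (norm_fderiv_curl_le hu2 x)
                (norm_le_toReal_of_enorm_le hU₀top.ne (hU₀ τ hτ x)) (norm_nonneg _) (by positivity)
          _ = c₂ * ‖iteratedFDeriv ℝ 2 (u τ) x‖ := by rw [hc₂]; ring
      have t3 : ‖convect (curl (u τ)) (u τ) x‖ ≤ c₃ * ‖iteratedFDeriv ℝ 1 (u τ) x‖ := by
        rw [convect_apply]
        calc ‖fderiv ℝ (u τ) x (curl (u τ) x)‖ ≤ ‖fderiv ℝ (u τ) x‖ * ‖curl (u τ) x‖ :=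
              ContinuousLinearMap.le_opNorm _ _
          _ ≤ ‖fderiv ℝ (u τ) x‖ * R.toReal :=
              mul_le_mul_of_nonneg_left (norm_le_toReal_of_enorm_le hRtop.ne (hR τ hτ x))
                (norm_nonneg _)
          _ = c₃ * ‖iteratedFDeriv ℝ 1 (u τ) x‖ := by
              rw [← norm_iteratedFDeriv_fderiv, norm_iteratedFDeriv_zero, hc₃]; ring
      rw [e0, add_zero]
      calc ‖ν • (Laplacian.laplacian (curl (u τ))) x - convect (u τ) (curl (u τ)) x +
              convect (curl (u τ)) (u τ) x‖
          ≤ ‖ν • (Laplacian.laplacian (curl (u τ))) x‖ + ‖convect (u τ) (curl (u τ)) x‖ +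
              ‖convect (curl (u τ)) (u τ) x‖ :=
            (norm_add_le _ _).trans (add_le_add (norm_sub_le _ _) le_rfl)
        _ ≤ _ := add_le_add (add_le_add t1 t2) t3
    have hm : ∀ k : ℕ, Measurable fun x => ‖iteratedFDeriv ℝ k (u τ) x‖ₑ := fun k =>
      (continuous_enorm.comp (hu.continuous_iteratedFDeriv (m := k) (by exact_mod_cast le_top))).measurable
    calc ∫⁻ x, ‖curl (timeDerivWithin (Icc a b) u τ) x‖ₑ ^ 2
        ≤ 3 * (ENNReal.ofReal (c₁ ^ 2) * ∫⁻ x, ‖iteratedFDeriv ℝ 3 (u τ) x‖ₑ ^ 2) +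
            3 * (ENNReal.ofReal (c₂ ^ 2) * ∫⁻ x, ‖iteratedFDeriv ℝ 2 (u τ) x‖ₑ ^ 2) +
            3 * (ENNReal.ofReal (c₃ ^ 2) * ∫⁻ x, ‖iteratedFDeriv ℝ 1 (u τ) x‖ₑ ^ 2) :=
          lintegral_enorm_sq_le_three (hm 2) (hm 1) hpt
      _ ≤ _ := by gcongr <;> exact hC _ τ hτ

/-- Cauchy–Schwarz: `(∫ f dμ)² ≤ μ(univ) · ∫ f² dμ`. [folklore] -/
private theorem lintegral_sq_le_measure_mul {α : Type*} [MeasurableSpace α] (μ : Measure α)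
    {f : α → ℝ≥0∞} (hf : AEMeasurable f μ) :
    (∫⁻ a, f a ∂μ) ^ 2 ≤ μ univ * ∫⁻ a, f a ^ 2 ∂μ := by
  have h := ENNReal.lintegral_mul_le_Lp_mul_Lq μ Real.HolderConjugate.two_two hf
    (aemeasurable_const (b := (1 : ℝ≥0∞)))
  simp only [Pi.mul_apply, mul_one, ENNReal.one_rpow, lintegral_const, one_mul] at h
  have e2 : ∀ a, f a ^ (2 : ℝ) = f a ^ 2 := fun a => by
    rw [show (2 : ℝ) = ((2 : ℕ) : ℝ) by norm_num, ENNReal.rpow_natCast]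
  simp_rw [e2] at h
  calc (∫⁻ a, f a ∂μ) ^ 2
      ≤ ((∫⁻ a, f a ^ 2 ∂μ) ^ (1 / 2 : ℝ) * (μ univ) ^ (1 / 2 : ℝ)) ^ 2 := pow_le_pow_left' h 2
    _ = μ univ * ∫⁻ a, f a ^ 2 ∂μ := by
        rw [← ENNReal.mul_rpow_of_nonneg _ _ (by norm_num : (0 : ℝ) ≤ 1 / 2),
          show (2 : ℕ) = (2 : ℕ) from rfl, ← ENNReal.rpow_natCast, ← ENNReal.rpow_mul]
        norm_num
        rw [mul_comm]

/-- **`L²`-Lipschitz continuity in time of the vorticity in the class**: for a jointly smooth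
velocity on `[a, b] × ℝ³` with `∫|curl ∂ₜu(τ)|² ≤ Λ` on `[a, b]`,
`∫|ω(t) − ω(s)|² ≤ (t − s)² Λ` for `a ≤ s ≤ t ≤ b` — the fundamental theorem of calculus along
each time line (`∂ₜω = curl ∂ₜu`, `hasDerivWithinAt_curl_slice`), Cauchy–Schwarz in time and
Tonelli (everything non-negative: no cut-offs, no decay needed). [folklore] -/
private theorem lintegral_curl_sub_sq_le {a b : ℝ}
    {u : ℝ → EuclideanSpace ℝ (Fin 3) → EuclideanSpace ℝ (Fin 3)}
    (h : IsSmoothSpaceTimeOn (Icc a b) u) (hab : a < b) {Λ : ℝ≥0∞}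
    (hΛ : ∀ τ ∈ Icc a b, ∫⁻ x, ‖curl (timeDerivWithin (Icc a b) u τ) x‖ₑ ^ 2 ≤ Λ)
    {s t : ℝ} (hs : s ∈ Icc a b) (ht : t ∈ Icc a b) (hst : s ≤ t) :
    ∫⁻ x, ‖curl (u t) x - curl (u s) x‖ₑ ^ 2 ≤ ENNReal.ofReal ((t - s) ^ 2) * Λ := by
  set S : Set ℝ := Icc a b with hSdef
  have hS : UniqueDiffOn ℝ S := uniqueDiffOn_Icc hab
  have hcl : S ⊆ closure (interior S) := by
    rw [hSdef, interior_Icc, closure_Ioo hab.ne]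
  set du := timeDerivWithin S u with hdu
  have hdu_sm : IsSmoothSpaceTimeOn S du := h.timeDerivWithin hS
  have hsub : Icc s t ⊆ S := Icc_subset_Icc hs.1 ht.2
  -- ### pointwise in `x`: FTC + Cauchy–Schwarz in time
  have hpt : ∀ x, ‖curl (u t) x - curl (u s) x‖ₑ ^ 2 ≤
      ENNReal.ofReal (t - s) * ∫⁻ σ in Ioc s t, ‖curl (du σ) x‖ₑ ^ 2 := by
    intro x
    have hcont : ContinuousOn (fun σ => curl (u σ) x) (Icc s t) := fun σ hσ =>
      ((hasDerivWithinAt_curl_slice h hS hcl (hsub hσ) x).continuousWithinAt).mono hsub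
    have hcont' : ContinuousOn (fun σ => curl (du σ) x) (Icc s t) := fun σ hσ =>
      ((hasDerivWithinAt_curl_slice hdu_sm hS hcl (hsub hσ) x).continuousWithinAt).mono hsub
    have hderiv : ∀ σ ∈ Ioo s t,
        HasDerivWithinAt (fun σ => curl (u σ) x) (curl (du σ) x) (Ioi σ) σ := by
      intro σ hσ
      have hσS : σ ∈ S := hsub (Ioo_subset_Icc_self hσ)
      refine (hasDerivWithinAt_curl_slice h hS hcl hσS x).mono_of_mem_nhdsWithin ?_
      exact mem_nhdsWithin_of_mem_nhds
        (Icc_mem_nhds (lt_of_le_of_lt hs.1 hσ.1) (lt_of_lt_of_le hσ.2 ht.2))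
    have hint : IntervalIntegrable (fun σ => curl (du σ) x) volume s t :=
      hcont'.intervalIntegrable_of_Icc hst
    have hftc := intervalIntegral.integral_eq_sub_of_hasDeriv_right_of_le hst hcont hderiv hint
    rw [intervalIntegral.integral_of_le hst] at hftc
    have hmeas : AEMeasurable (fun σ => ‖curl (du σ) x‖ₑ) (volume.restrict (Ioc s t)) :=
      ((hcont'.mono Ioc_subset_Icc_self).aestronglyMeasurable measurableSet_Ioc).enorm
    calc ‖curl (u t) x - curl (u s) x‖ₑ ^ 2
        = ‖∫ σ in Ioc s t, curl (du σ) x‖ₑ ^ 2 := by rw [hftc]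
      _ ≤ (∫⁻ σ in Ioc s t, ‖curl (du σ) x‖ₑ) ^ 2 :=
          pow_le_pow_left' (enorm_integral_le_lintegral_enorm _) 2
      _ ≤ (volume.restrict (Ioc s t)) univ * ∫⁻ σ in Ioc s t, ‖curl (du σ) x‖ₑ ^ 2 :=
          lintegral_sq_le_measure_mul _ hmeas
      _ = ENNReal.ofReal (t - s) * ∫⁻ σ in Ioc s t, ‖curl (du σ) x‖ₑ ^ 2 := by
          rw [Measure.restrict_apply_univ, Real.volume_Ioc]
  -- ### Tonelli
  have hG : ContinuousOn
      (fun z : EuclideanSpace ℝ (Fin 3) × ℝ => curlCLM (fderiv ℝ (du z.2) z.1)) (univ ×ˢ S) := by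
    have hW : ContinuousOn (uncurry fun σ y => fderiv ℝ (du σ) y) (S ×ˢ univ) :=
      (hdu_sm.fderiv_slice hS).continuousOn
    have hsw : ContinuousOn (fun z : EuclideanSpace ℝ (Fin 3) × ℝ => fderiv ℝ (du z.2) z.1)
        (univ ×ˢ S) := by
      refine hW.comp continuous_swap.continuousOn fun z hz => ?_
      exact ⟨hz.2, hz.1⟩
    exact curlCLM.continuous.comp_continuousOn hsw
  have hmeas2 : AEMeasurable
      (uncurry fun (x : EuclideanSpace ℝ (Fin 3)) (σ : ℝ) => ‖curl (du σ) x‖ₑ ^ 2)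
      ((volume : Measure (EuclideanSpace ℝ (Fin 3))).prod (volume.restrict (Ioc s t))) := by
    have hset : MeasurableSet ((univ : Set (EuclideanSpace ℝ (Fin 3))) ×ˢ Ioc s t) :=
      MeasurableSet.univ.prod measurableSet_Ioc
    have hc : ContinuousOn
        (fun z : EuclideanSpace ℝ (Fin 3) × ℝ => ‖curlCLM (fderiv ℝ (du z.2) z.1)‖ₑ ^ 2)
        (univ ×ˢ Ioc s t) :=
      ((ENNReal.continuous_pow 2).comp continuous_enorm).comp_continuousOn
        (hG.mono (prod_mono Subset.rfl (Ioc_subset_Icc_self.trans hsub)))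
    have e : (volume : Measure (EuclideanSpace ℝ (Fin 3))).prod (volume.restrict (Ioc s t)) =
        ((volume : Measure (EuclideanSpace ℝ (Fin 3))).prod (volume : Measure ℝ)).restrict
          (univ ×ˢ Ioc s t) := by
      rw [← Measure.prod_restrict, Measure.restrict_univ]
    have efun : (uncurry fun (x : EuclideanSpace ℝ (Fin 3)) (σ : ℝ) => ‖curl (du σ) x‖ₑ ^ 2) =
        fun z : EuclideanSpace ℝ (Fin 3) × ℝ => ‖curlCLM (fderiv ℝ (du z.2) z.1)‖ₑ ^ 2 := by
      funext z
      obtain ⟨x, σ⟩ := z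
      simp only [uncurry_apply_pair, curl_eq_curlCLM]
    rw [e, efun]
    exact hc.aemeasurable hset
  calc ∫⁻ x, ‖curl (u t) x - curl (u s) x‖ₑ ^ 2
      ≤ ∫⁻ x, ENNReal.ofReal (t - s) * ∫⁻ σ in Ioc s t, ‖curl (du σ) x‖ₑ ^ 2 :=
        lintegral_mono hpt
    _ = ENNReal.ofReal (t - s) * ∫⁻ σ in Ioc s t, ∫⁻ x, ‖curl (du σ) x‖ₑ ^ 2 := by
        rw [lintegral_const_mul' _ _ ENNReal.ofReal_ne_top, lintegral_lintegral_swap hmeas2]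
    _ ≤ ENNReal.ofReal (t - s) * ∫⁻ σ in Ioc s t, Λ :=
        mul_le_mul' le_rfl
          (setLIntegral_mono measurable_const fun σ hσ => hΛ σ (hsub (Ioc_subset_Icc_self hσ)))
    _ = ENNReal.ofReal ((t - s) ^ 2) * Λ := by
        rw [setLIntegral_const, Real.volume_Ioc, sq, ENNReal.ofReal_mul (sub_nonneg.2 hst)]
        ring

/-- The `Lⁿ` norm with `n : ℕ`, `n ≥ 1`, as a real power of the integral of the `n`-th power. [folklore] -/
private theorem eLpNorm_nat_eq (f : EuclideanSpace ℝ (Fin 3) → EuclideanSpace ℝ (Fin 3)) {n : ℕ}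
    (hn : 1 ≤ n) : eLpNorm f (n : ℝ≥0∞) volume = (∫⁻ x, ‖f x‖ₑ ^ n) ^ (1 / (n : ℝ)) := by
  have hn0 : (n : ℝ≥0∞) ≠ 0 := by exact_mod_cast (Nat.one_le_iff_ne_zero.1 hn)
  rw [eLpNorm_eq_lintegral_rpow_enorm_toReal hn0 (ENNReal.natCast_ne_top n), ENNReal.toReal_natCast]
  congr 1
  refine lintegral_congr fun x => ?_
  rw [ENNReal.rpow_natCast]

/-- **Step 9 `ImplicitContinuity` HOLDS**: in the class, `t ↦ |ω|_n(t) = ‖curl u(t)‖_{Lⁿ}` is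
continuous on `[t₁, t₂]` for every `n ≥ 2`. The vorticity line `τ ↦ ω(τ, x)` has one-sided
derivative `curl ∂ₜu(τ, x)` on the closed slab (`hasDerivWithinAt_curl_slice`), and
`sup_τ ∫|curl ∂ₜu(τ)|² < ∞` by the curl of the momentum equation and the Sobolev bounds
(`exists_lintegral_curl_timeDerivWithin_sq_le`); the fundamental theorem of calculus,
Cauchy–Schwarz in time and Tonelli give `‖ω(t) − ω(s)‖²_{L²} ≤ Λ (t − s)²`
(`lintegral_curl_sub_sq_le`), and with the uniform bound `|ω| ≤ R` of the class,
`‖ω(t) − ω(s)‖ⁿ_{Lⁿ} ≤ (2R)ⁿ⁻² Λ (t − s)² → 0`; the triangle inequality in `Lⁿ` concludes. The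
VERDICT of record (#39, locator `Inference50`, class false lemma) is untouched; after this theorem
the inputs of `claim_of_steps` are kernel-decided except Steps 2 `Ineq45` and 10 `KuLocal`.
[cite: Ruzmaikina2008NSVorticityBounds, p.22 («assume that … |ω|_n(t) is continuous»), p.23] -/
theorem implicitContinuity_holds : ImplicitContinuity := by
  intro ν t₁ t₂ u p hν ht hsol n hn
  -- ### class facts
  have hS : IsClassicalNSSolutionOn (Icc t₁ t₂) ν 0 u p := hsol.isClassical
  have hsm : ∀ s ∈ Icc t₁ t₂, ContDiff ℝ ∞ (u s) := fun s hs => hS.contDiff_velocity hs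
  obtain ⟨R, hRtop, hR⟩ := exists_enorm_curl_le_of_hasBoundedSobolevNormsOn hsm hsol.sobolev
  obtain ⟨Λ, hΛtop, hΛ⟩ := exists_lintegral_curl_timeDerivWithin_sq_le hsol ht
  obtain ⟨C₁, hC₁⟩ := hsol.sobolev 1
  have hcont : ∀ s ∈ Icc t₁ t₂, Continuous (curl (u s)) := fun s hs =>
    continuous_curl ((hsm s hs).of_le (by exact_mod_cast le_top))
  have hn1 : 1 ≤ n := le_trans (by norm_num) hn
  have hn1' : (1 : ℝ≥0∞) ≤ n := by exact_mod_cast hn1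
  have hnpos : (0 : ℝ) < 1 / (n : ℝ) := by
    have : (0 : ℝ) < n := by exact_mod_cast (lt_of_lt_of_le (by norm_num) hn1)
    positivity
  have hRR : R + R ≠ ⊤ := ENNReal.add_ne_top.2 ⟨hRtop.ne, hRtop.ne⟩
  -- every `|ω|_n(s)`, `s ∈ [t₁,t₂]`, is finite
  have hfin : ∀ s ∈ Icc t₁ t₂, eLpNorm (curl (u s)) (n : ℝ≥0∞) volume ≠ ⊤ := by
    intro s hs
    have hEss : eLpNormEssSup (curl (u s)) volume ≠ ⊤ :=
      ((eLpNormEssSup_le_of_ae_enorm_bound (Eventually.of_forall (hR s hs))).trans_lt hRtop).ne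
    have hI2 : ∫⁻ x, ‖curl (u s) x‖ₑ ^ 2 < ⊤ :=
      lt_of_le_of_lt ((lintegral_curl_sq_le (u s)).trans (mul_le_mul' le_rfl (hC₁ s hs)))
        (ENNReal.mul_lt_top ENNReal.ofReal_lt_top ENNReal.coe_lt_top)
    have hIn : ∫⁻ x, ‖curl (u s) x‖ₑ ^ n < ⊤ :=
      lt_of_le_of_lt (lintegral_pow_le_essSup_pow_mul _ hn hEss)
        (ENNReal.mul_lt_top ((ENNReal.pow_ne_top hEss).lt_top) hI2)
    rw [eLpNorm_nat_eq _ hn1]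
    exact ENNReal.rpow_ne_top_of_nonneg hnpos.le hIn.ne
  -- ### the modulus `Ψ(r) = ((2R)ⁿ⁻² Λ r²)^{1/n}`
  set Ψ : ℝ → ℝ≥0∞ := fun r =>
    ((R + R) ^ (n - 2) * (ENNReal.ofReal (r ^ 2) * Λ)) ^ (1 / (n : ℝ)) with hΨ
  have hΨtop : ∀ r, Ψ r ≠ ⊤ := fun r =>
    ENNReal.rpow_ne_top_of_nonneg hnpos.le
      (ENNReal.mul_ne_top (ENNReal.pow_ne_top hRR) (ENNReal.mul_ne_top ENNReal.ofReal_ne_top hΛtop))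
  -- ### the key estimate `‖ω(a) − ω(b)‖_{Lⁿ} ≤ Ψ(a − b)`
  have key : ∀ a ∈ Icc t₁ t₂, ∀ b ∈ Icc t₁ t₂,
      eLpNorm (fun x => curl (u a) x - curl (u b) x) (n : ℝ≥0∞) volume ≤ Ψ (a - b) := by
    intro a ha b hb
    set f : EuclideanSpace ℝ (Fin 3) → EuclideanSpace ℝ (Fin 3) := fun x => curl (u a) x - curl (u b) x
      with hf
    have hEf : eLpNormEssSup f volume ≤ R + R :=
      eLpNormEssSup_le_of_ae_enorm_bound (Eventually.of_forall fun x =>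
        (enorm_sub_le (E := EuclideanSpace ℝ (Fin 3))).trans (add_le_add (hR a ha x) (hR b hb x)))
    have hEftop : eLpNormEssSup f volume ≠ ⊤ := (hEf.trans_lt hRR.lt_top).ne
    have h2 : ∫⁻ x, ‖f x‖ₑ ^ 2 ≤ ENNReal.ofReal ((a - b) ^ 2) * Λ := by
      rcases le_total b a with hba | hab
      · exact lintegral_curl_sub_sq_le hS.smooth_velocity ht hΛ hb ha hba
      · have h' := lintegral_curl_sub_sq_le hS.smooth_velocity ht hΛ ha hb hab
        have e1 : (b - a) ^ 2 = (a - b) ^ 2 := by ring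
        rw [e1] at h'
        refine le_of_eq_of_le (lintegral_congr fun x => ?_) h'
        rw [hf]
        exact congrArg (· ^ 2) (enorm_sub_rev _ _)
    have h1 : ∫⁻ x, ‖f x‖ₑ ^ n ≤ (R + R) ^ (n - 2) * (ENNReal.ofReal ((a - b) ^ 2) * Λ) :=
      (lintegral_pow_le_essSup_pow_mul f hn hEftop).trans
        (mul_le_mul' (pow_le_pow_left' hEf _) h2)
    rw [eLpNorm_nat_eq _ hn1, hΨ]
    exact ENNReal.rpow_le_rpow h1 hnpos.le
  -- ### `Ψ(a − b) → 0` as `a → b`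
  have hΨlim : ∀ b : ℝ, Tendsto (fun a => (Ψ (a - b)).toReal) (𝓝 b) (𝓝 0) := by
    intro b
    have h0 : Tendsto (fun a : ℝ => (a - b) ^ 2) (𝓝 b) (𝓝 0) := by
      have hc : Continuous fun a : ℝ => (a - b) ^ 2 := (continuous_id.sub continuous_const).pow 2
      have := hc.tendsto b
      simpa using this
    have h1 : Tendsto (fun a : ℝ => ENNReal.ofReal ((a - b) ^ 2)) (𝓝 b) (𝓝 0) := by
      have := (ENNReal.continuous_ofReal.tendsto 0).comp h0
      rwa [ENNReal.ofReal_zero] at this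
    have h2 : Tendsto (fun a : ℝ => ENNReal.ofReal ((a - b) ^ 2) * Λ) (𝓝 b) (𝓝 0) := by
      have := ENNReal.Tendsto.mul_const h1 (Or.inr hΛtop)
      rwa [zero_mul] at this
    have h3 : Tendsto (fun a : ℝ => (R + R) ^ (n - 2) * (ENNReal.ofReal ((a - b) ^ 2) * Λ)) (𝓝 b)
        (𝓝 0) := by
      have := ENNReal.Tendsto.const_mul (a := (R + R) ^ (n - 2)) h2
        (Or.inr (ENNReal.pow_ne_top hRR))
      rwa [mul_zero] at this
    have h4 : Tendsto (fun a : ℝ => Ψ (a - b)) (𝓝 b) (𝓝 0) := by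
      have := ((ENNReal.continuous_rpow_const (y := 1 / (n : ℝ))).tendsto 0).comp h3
      rwa [ENNReal.zero_rpow_of_pos hnpos] at this
    have h5 := (ENNReal.tendsto_toReal ENNReal.zero_ne_top).comp h4
    rwa [ENNReal.toReal_zero] at h5
  -- ### continuity
  intro b hb
  have hB := hfin b hb
  rw [ContinuousWithinAt, tendsto_iff_norm_sub_tendsto_zero]
  refine squeeze_zero' (Eventually.of_forall fun a => norm_nonneg _) ?_
    ((hΨlim b).mono_left nhdsWithin_le_nhds)
  filter_upwards [self_mem_nhdsWithin] with a ha
  have hA := hfin a ha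
  have hmeas : ∀ s ∈ Icc t₁ t₂, AEStronglyMeasurable (curl (u s)) volume := fun s hs =>
    (hcont s hs).aestronglyMeasurable
  -- `‖ω(a)‖ ≤ Ψ + ‖ω(b)‖` and `‖ω(b)‖ ≤ Ψ + ‖ω(a)‖`
  have hAB : eLpNorm (curl (u a)) (n : ℝ≥0∞) volume ≤
      Ψ (a - b) + eLpNorm (curl (u b)) (n : ℝ≥0∞) volume := by
    have e1 : curl (u a) = (fun x => curl (u a) x - curl (u b) x) + curl (u b) := by
      funext x; simp
    calc eLpNorm (curl (u a)) (n : ℝ≥0∞) volume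
        = eLpNorm ((fun x => curl (u a) x - curl (u b) x) + curl (u b)) (n : ℝ≥0∞) volume := by
          rw [← e1]
      _ ≤ eLpNorm (fun x => curl (u a) x - curl (u b) x) (n : ℝ≥0∞) volume +
            eLpNorm (curl (u b)) (n : ℝ≥0∞) volume :=
          eLpNorm_add_le ((hmeas a ha).sub (hmeas b hb)) (hmeas b hb) hn1'
      _ ≤ _ := add_le_add (key a ha b hb) le_rfl
  have hBA : eLpNorm (curl (u b)) (n : ℝ≥0∞) volume ≤
      Ψ (a - b) + eLpNorm (curl (u a)) (n : ℝ≥0∞) volume := by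
    have e1 : curl (u b) = (fun x => curl (u b) x - curl (u a) x) + curl (u a) := by
      funext x; simp
    have e2 : Ψ (b - a) = Ψ (a - b) := by
      simp only [hΨ]; rw [show (b - a) ^ 2 = (a - b) ^ 2 by ring]
    calc eLpNorm (curl (u b)) (n : ℝ≥0∞) volume
        = eLpNorm ((fun x => curl (u b) x - curl (u a) x) + curl (u a)) (n : ℝ≥0∞) volume := by
          rw [← e1]
      _ ≤ eLpNorm (fun x => curl (u b) x - curl (u a) x) (n : ℝ≥0∞) volume +
            eLpNorm (curl (u a)) (n : ℝ≥0∞) volume :=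
          eLpNorm_add_le ((hmeas b hb).sub (hmeas a ha)) (hmeas a ha) hn1'
      _ ≤ _ := add_le_add ((key b hb a ha).trans_eq e2) le_rfl
  have hΨab := hΨtop (a - b)
  have r1 : (eLpNorm (curl (u a)) (n : ℝ≥0∞) volume).toReal ≤
      (Ψ (a - b)).toReal + (eLpNorm (curl (u b)) (n : ℝ≥0∞) volume).toReal := by
    rw [← ENNReal.toReal_add hΨab hB]
    exact ENNReal.toReal_mono (ENNReal.add_ne_top.2 ⟨hΨab, hB⟩) hAB
  have r2 : (eLpNorm (curl (u b)) (n : ℝ≥0∞) volume).toReal ≤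
      (Ψ (a - b)).toReal + (eLpNorm (curl (u a)) (n : ℝ≥0∞) volume).toReal := by
    rw [← ENNReal.toReal_add hΨab hA]
    exact ENNReal.toReal_mono (ENNReal.add_ne_top.2 ⟨hΨab, hA⟩) hBA
  unfold vortNorm
  rw [Real.norm_eq_abs]
  exact abs_sub_le_iff.2 ⟨by linarith, by linarith⟩

/-- `ImplicitContinuity` — `_holds` alias of `implicitContinuity_holds` above under the fact's exact name (appended
2026-08-28, D-0026 bookkeeping: the proof term is the existing theorem of this file; no statement,
definition or attribute is edited; no new named fact; the ledger's debt table listed the fact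
unproved). [cite: Ruzmaikina2008NSVorticityBounds, p.22 («assume that … |ω|_n(t) is continuous»), p.23] -/
theorem _root_.Literature.Claims.NS.Ruzmaikina2008.ImplicitContinuity_holds : ImplicitContinuity :=
  _root_.Literature.Claims.NS.Ruzmaikina2008.implicitContinuity_holds

/-! ### Kernel certificate (D-0026-neutral, 2026-08-27): Step 10 `KuLocal` is CLAY-STRENGTH — the [Ku]-step as imported
gives the headline by scaling

APPEND-ONLY addition after ADJUDICATED #39 (locator `Inference50`, class false lemma — UNTOUCHED): no discharge and no
refutation; a kernel RELATION `KuLocal → ClaimedTheorem` (hence `→ clayR3.Regularity`). One import added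
(`Literature.Analysis.FluidPDE.ClassicalSolutionRescale`, the tree's scaling covariance of classical solutions);
nothing else in this file is edited. -/

/-- Chain-rule bound for rescaled data: `‖Dⁿ(c w(c ·))(y)‖ ≤ |c|ⁿ⁺¹ ‖Dⁿw(c y)‖` (private copy of the tree's
`norm_iteratedFDeriv_nsRescaleData_le`, `TaoQuantitativeReduction`, foreign import closure). [folklore] -/
private theorem norm_iteratedFDeriv_nsRescaleData_le' {w : EuclideanSpace ℝ (Fin 3) → EuclideanSpace ℝ (Fin 3)}
    {n : ℕ} (hw : ContDiff ℝ n w) (c : ℝ) (y : EuclideanSpace ℝ (Fin 3)) :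
    ‖iteratedFDeriv ℝ n (nsRescaleData c w) y‖ ≤ |c| ^ (n + 1) * ‖iteratedFDeriv ℝ n w (c • y)‖ := by
  set g : EuclideanSpace ℝ (Fin 3) →L[ℝ] EuclideanSpace ℝ (Fin 3) :=
    c • ContinuousLinearMap.id ℝ (EuclideanSpace ℝ (Fin 3)) with hg
  have hg' : ∀ z, g z = c • z := fun z => rfl
  have h1 : nsRescaleData c w = fun z => c • (w ∘ g) z := by
    funext z
    simp [nsRescaleData_apply, hg']
  have hcomp : ContDiff ℝ n (w ∘ g) := hw.comp g.contDiff
  have hgn : ‖g‖ ≤ |c| := by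
    calc ‖g‖ = ‖c‖ * ‖ContinuousLinearMap.id ℝ (EuclideanSpace ℝ (Fin 3))‖ := norm_smul c _
      _ ≤ |c| * 1 := by
        rw [Real.norm_eq_abs]
        exact mul_le_mul_of_nonneg_left ContinuousLinearMap.norm_id_le (abs_nonneg c)
      _ = |c| := mul_one _
  rw [h1, iteratedFDeriv_const_smul_apply' hcomp.contDiffAt, norm_smul, Real.norm_eq_abs,
    g.iteratedFDeriv_comp_right hw y le_rfl, pow_succ', mul_assoc]
  refine mul_le_mul_of_nonneg_left ?_ (abs_nonneg c)
  calc ‖(iteratedFDeriv ℝ n w (g y)).compContinuousLinearMap fun _ => g‖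
      ≤ ‖iteratedFDeriv ℝ n w (g y)‖ * ∏ _i : Fin n, ‖g‖ :=
        ContinuousMultilinearMap.norm_compContinuousLinearMap_le _ _
    _ ≤ ‖iteratedFDeriv ℝ n w (g y)‖ * |c| ^ n := by
        rw [Fin.prod_const]
        exact mul_le_mul_of_nonneg_left (pow_le_pow_left₀ (norm_nonneg _) hgn n) (norm_nonneg _)
    _ = |c| ^ n * ‖iteratedFDeriv ℝ n w (c • y)‖ := by rw [hg', mul_comm]

/-- `∫⁻ ‖Dⁿ(c w(c ·))‖ₑ² ≤ c^{2n+2} (c³)⁻¹ ∫⁻ ‖Dⁿw‖ₑ²` for `c > 0`, `w ∈ Cⁿ`. [folklore] -/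
private theorem lintegral_iteratedFDeriv_nsRescaleData_le {w : EuclideanSpace ℝ (Fin 3) → EuclideanSpace ℝ (Fin 3)}
    {n : ℕ} (hw : ContDiff ℝ n w) {c : ℝ} (hc : 0 < c) :
    ∫⁻ x, ‖iteratedFDeriv ℝ n (nsRescaleData c w) x‖ₑ ^ 2 ≤
      ENNReal.ofReal ((c ^ (n + 1)) ^ 2) * (ENNReal.ofReal (c ^ 3)⁻¹ * ∫⁻ x, ‖iteratedFDeriv ℝ n w x‖ₑ ^ 2) := by
  have h1 : ∀ x, ‖iteratedFDeriv ℝ n (nsRescaleData c w) x‖ₑ ^ 2 ≤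
      ENNReal.ofReal ((c ^ (n + 1)) ^ 2) * (fun y => ‖iteratedFDeriv ℝ n w y‖ₑ ^ 2) ((0 : EuclideanSpace ℝ (Fin 3)) + c • x) := by
    intro x
    have hb := norm_iteratedFDeriv_nsRescaleData_le' hw c x
    rw [abs_of_pos hc] at hb
    rw [zero_add]
    calc ‖iteratedFDeriv ℝ n (nsRescaleData c w) x‖ₑ ^ 2
        = ENNReal.ofReal (‖iteratedFDeriv ℝ n (nsRescaleData c w) x‖ ^ 2) := by
          rw [← ofReal_norm, ENNReal.ofReal_pow (norm_nonneg _)]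
      _ ≤ ENNReal.ofReal ((c ^ (n + 1) * ‖iteratedFDeriv ℝ n w (c • x)‖) ^ 2) :=
          ENNReal.ofReal_le_ofReal (pow_le_pow_left₀ (norm_nonneg _) hb 2)
      _ = ENNReal.ofReal ((c ^ (n + 1)) ^ 2) * ‖iteratedFDeriv ℝ n w (c • x)‖ₑ ^ 2 := by
          rw [mul_pow, ENNReal.ofReal_mul (sq_nonneg _), ← ofReal_norm, ENNReal.ofReal_pow (norm_nonneg _)]
  calc ∫⁻ x, ‖iteratedFDeriv ℝ n (nsRescaleData c w) x‖ₑ ^ 2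
      ≤ ∫⁻ x, ENNReal.ofReal ((c ^ (n + 1)) ^ 2) *
          (fun y => ‖iteratedFDeriv ℝ n w y‖ₑ ^ 2) ((0 : EuclideanSpace ℝ (Fin 3)) + c • x) :=
        lintegral_mono h1
    _ = _ := by
        rw [lintegral_const_mul' _ _ ENNReal.ofReal_ne_top,
          lintegral_comp_space_affine hc (0 : EuclideanSpace ℝ (Fin 3))
            (fun y => ‖iteratedFDeriv ℝ n w y‖ₑ ^ 2),
          finrank_euclideanSpace_fin]

/-- Chain rule: `D(c w(c ·))(x) = c² Dw(c x)`. [folklore] -/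
private theorem fderiv_nsRescaleData {w : EuclideanSpace ℝ (Fin 3) → EuclideanSpace ℝ (Fin 3)}
    (hw : Differentiable ℝ w) (c : ℝ) (x : EuclideanSpace ℝ (Fin 3)) :
    fderiv ℝ (nsRescaleData c w) x = (c * c) • fderiv ℝ w (c • x) := by
  set g : EuclideanSpace ℝ (Fin 3) →L[ℝ] EuclideanSpace ℝ (Fin 3) :=
    c • ContinuousLinearMap.id ℝ (EuclideanSpace ℝ (Fin 3)) with hg
  have hfun : nsRescaleData c w = fun z => c • (w ∘ g) z := by
    funext z; simp [nsRescaleData_apply, hg]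
  have hA : HasFDerivAt (fun z => c • (w ∘ g) z) (c • ((fderiv ℝ w (g x)).comp g)) x :=
    (((hw (g x)).hasFDerivAt.comp x g.hasFDerivAt).const_smul c)
  have hE : c • ((fderiv ℝ w (g x)).comp g) = (c * c) • fderiv ℝ w (c • x) := by
    refine ContinuousLinearMap.ext fun v => ?_
    simp only [FunLike.coe_smul, Pi.smul_apply, ContinuousLinearMap.comp_apply, hg,
      ContinuousLinearMap.id_apply, map_smul, smul_smul]
  rw [hfun, hA.fderiv, hE]

/-- `curl (c w(c ·))(x) = c² (curl w)(c x)`. [folklore] -/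
private theorem curl_nsRescaleData {w : EuclideanSpace ℝ (Fin 3) → EuclideanSpace ℝ (Fin 3)}
    (hw : Differentiable ℝ w) (c : ℝ) (x : EuclideanSpace ℝ (Fin 3)) :
    curl (nsRescaleData c w) x = (c * c) • curl w (c • x) := by
  rw [curl_eq_curlCLM, fderiv_nsRescaleData hw, map_smul, ← curl_eq_curlCLM]

/-- The data class is scale invariant: `u₀ ∈ 𝒟 ⇒ c u₀(c ·) ∈ 𝒟` (`c > 0`). [folklore] -/
private theorem isDatum_nsRescaleData {u₀ : EuclideanSpace ℝ (Fin 3) → EuclideanSpace ℝ (Fin 3)}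
    (h : IsDatum u₀) {c : ℝ} (hc : 0 < c) : IsDatum (nsRescaleData c u₀) := by
  obtain ⟨hsm, hdiv, hH⟩ := h
  set g : EuclideanSpace ℝ (Fin 3) →L[ℝ] EuclideanSpace ℝ (Fin 3) :=
    c • ContinuousLinearMap.id ℝ (EuclideanSpace ℝ (Fin 3)) with hg
  have hfun : nsRescaleData c u₀ = fun z => c • (u₀ ∘ g) z := by
    funext z; simp [nsRescaleData_apply, hg]
  have hsm' : ContDiff ℝ ∞ (nsRescaleData c u₀) := by
    rw [hfun]; exact (hsm.comp g.contDiff).const_smul c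
  refine ⟨hsm', fun x => ?_, fun n => ?_⟩
  · -- divergence: `D(c u₀(c·))(x) = c² Du₀(cx)`, the trace scales
    have h0 := hdiv (c • x)
    unfold VectorCalculus.divergence at h0 ⊢
    rw [fderiv_nsRescaleData (hsm.differentiable (by simp)), ContinuousLinearMap.toLinearMap_smul,
      LinearMap.map_smul, h0, smul_zero]
  · exact lt_of_le_of_lt (lintegral_iteratedFDeriv_nsRescaleData_le (hsm.of_le (by exact_mod_cast le_top)) hc)
      (ENNReal.mul_lt_top ENNReal.ofReal_lt_top (ENNReal.mul_lt_top ENNReal.ofReal_lt_top (hH n)))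

/-- `(c² ·)⁻¹' [0, b] = [0, b/c²]` for `c ≠ 0`. [folklore] -/
private theorem preimage_mul_sq_Icc {c b : ℝ} (hc : 0 < c) :
    (fun t => c ^ 2 * t) ⁻¹' Icc 0 b = Icc 0 (b / c ^ 2) := by
  have hc2 : 0 < c ^ 2 := by positivity
  ext t
  simp only [mem_preimage, mem_Icc]
  rw [le_div_iff₀' hc2]
  constructor
  · rintro ⟨h1, h2⟩
    exact ⟨(mul_nonneg_iff_of_pos_left hc2).1 h1, h2⟩
  · rintro ⟨h1, h2⟩
    exact ⟨mul_nonneg hc2.le h1, h2⟩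

/-- **The class is scale covariant**: a class solution on `[0, b]` rescales under
`u ↦ c u(c²·, c·)`, `p ↦ c² p(c²·, c·)` (`c > 0`, viscosity unchanged) to a class solution on `[0, b/c²]`
(tree `IsClassicalNSSolutionOn.nsRescale_holds`; the Sobolev bounds rescale by constants). [folklore] -/
private theorem isSolutionOn_nsRescale {ν b : ℝ}
    {U : ℝ → EuclideanSpace ℝ (Fin 3) → EuclideanSpace ℝ (Fin 3)} {P : ℝ → EuclideanSpace ℝ (Fin 3) → ℝ}
    (h : IsSolutionOn ν 0 b U P) {c : ℝ} (hc : 0 < c) :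
    IsSolutionOn ν 0 (b / c ^ 2) (nsRescale c U) (nsRescalePressure c P) := by
  have hpre := preimage_mul_sq_Icc (b := b) hc
  refine ⟨?_, fun n => ?_⟩
  · have key := IsClassicalNSSolutionOn.nsRescale_holds h.isClassical hc
    rw [nsRescaleForce_zero, hpre] at key
    exact key
  · obtain ⟨C, hC⟩ := h.sobolev n
    set K : ℝ≥0∞ := ENNReal.ofReal ((c ^ (n + 1)) ^ 2) * (ENNReal.ofReal (c ^ 3)⁻¹ * C) with hK
    have hKtop : K ≠ ⊤ := ENNReal.mul_ne_top ENNReal.ofReal_ne_top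
      (ENNReal.mul_ne_top ENNReal.ofReal_ne_top ENNReal.coe_ne_top)
    refine ⟨K.toNNReal, fun t ht => ?_⟩
    have ht' : c ^ 2 * t ∈ Icc 0 b := by
      have : t ∈ (fun t => c ^ 2 * t) ⁻¹' Icc 0 b := by rw [hpre]; exact ht
      exact this
    have hw : ContDiff ℝ n (U (c ^ 2 * t)) :=
      (h.isClassical.contDiff_velocity ht').of_le (by exact_mod_cast le_top)
    have hslice : nsRescale c U t = nsRescaleData c (U (c ^ 2 * t)) := rfl
    rw [hslice, ENNReal.coe_toNNReal hKtop, hK]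
    exact (lintegral_iteratedFDeriv_nsRescaleData_le hw hc).trans
      (mul_le_mul' le_rfl (mul_le_mul' le_rfl (hC _ ht')))

/-- **From the [Ku]-step to every horizon, by scaling.** If `LocalStep C ν` holds, then every datum of the class
has a class solution on `[0, T]` for EVERY `T > 0`: rescale the datum to `v = c u₀(c ·)` with
`c² = ν/(2CM²T)` (`M ≥ sup|curl u₀|`, `sup|curl v| ≤ c²M`), apply the step to `v` — a solution on
`[0, ν/(2C(c²M)²)]` — and scale back by `c⁻¹`, which stretches time by `c²`: the horizon becomes
`c² · ν/(2Cc⁴M²) = T`. The step length `ν/(2C|ω|²_∞)` scales like `λ⁻⁴` under `u ↦ λu(λ²t, λx)` while times scale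
like `λ⁻²` — the typist's flag «`ν/|ω|_∞²` is not a time» made a kernel fact. [cite: Ruzmaikina2008NSVorticityBounds, Proof of Theorem 3 p.22] -/
theorem exists_isSolution_of_localStep {C ν : ℝ} (hC : 0 < C) (hν : 0 < ν) (hL : LocalStep C ν)
    {u₀ : EuclideanSpace ℝ (Fin 3) → EuclideanSpace ℝ (Fin 3)} (hu₀ : IsDatum u₀) {T : ℝ} (hT : 0 < T) :
    ∃ (u : ℝ → EuclideanSpace ℝ (Fin 3) → EuclideanSpace ℝ (Fin 3)) (p : ℝ → EuclideanSpace ℝ (Fin 3) → ℝ),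
      IsSolution ν T u₀ u p := by
  obtain ⟨R, hRtop, hR⟩ := exists_curl_bound_of_isDatum hu₀
  set M : ℝ := R.toReal + 1 with hM
  have hM0 : 0 < M := by positivity
  have hcurl : ∀ x, ‖curl u₀ x‖ ≤ M := fun x =>
    (norm_le_toReal_of_enorm_le hRtop.ne (hR x)).trans (le_add_of_nonneg_right zero_le_one)
  set c : ℝ := Real.sqrt (ν / (2 * C * M ^ 2 * T)) with hc_def
  have hc : 0 < c := Real.sqrt_pos.2 (by positivity)
  have hc2 : c ^ 2 = ν / (2 * C * M ^ 2 * T) := Real.sq_sqrt (by positivity)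
  -- the rescaled datum and the [Ku]-step applied to it
  have hv : IsDatum (nsRescaleData c u₀) := isDatum_nsRescaleData hu₀ hc
  have hM' : 0 < c ^ 2 * M := by positivity
  have hcurl' : ∀ x, ‖curl (nsRescaleData c u₀) x‖ ≤ c ^ 2 * M := fun x => by
    rw [curl_nsRescaleData (hu₀.1.differentiable (by simp)), norm_smul, Real.norm_eq_abs,
      abs_of_pos (mul_pos hc hc), ← sq]
    exact mul_le_mul_of_nonneg_left (hcurl _) (by positivity)
  obtain ⟨U, P, hsol, hU0⟩ := hL 0 (c ^ 2 * M) (nsRescaleData c u₀) hM' hv hcurl'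
  -- scale back by `c⁻¹`
  have hsol' := isSolutionOn_nsRescale hsol (inv_pos.2 hc)
  have hT' : (0 + ν / (2 * C * (c ^ 2 * M) ^ 2)) / c⁻¹ ^ 2 = T := by
    rw [zero_add, inv_pow, div_inv_eq_mul]
    have hc0 : c ≠ 0 := hc.ne'
    have h2 : c ^ 2 * (2 * C * M ^ 2 * T) = ν := by
      rw [hc2]; field_simp
    field_simp
    nlinarith [h2]
  rw [hT'] at hsol'
  refine ⟨nsRescale c⁻¹ U, nsRescalePressure c⁻¹ P, ⟨hsol', ?_⟩⟩
  rw [nsRescale_zero_time, hU0]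
  funext x
  simp [nsRescaleData_apply, smul_smul, hc.ne']

/-- **Step 10 `KuLocal` ALONE gives the headline** (`ClaimedTheorem`: existence on every `[0,T]` by
`exists_isSolution_of_localStep`, uniqueness by the tree's `IsClassicalNSSolutionOn.eq_of_hasBoundedSobolevNormsOn`) —
the local existence theorem «as imported» (one constant `C` for the step length `ν/(2C|ω|_∞²(0))`, p. 22) is, by the
Navier–Stokes scaling, as strong as global regularity in the class; in particular (with `clay_of_claimed`) it implies
Clay (A). A kernel record ALONGSIDE #39 (locator `Inference50`, false lemma — untouched): the paper's use of [Ku] is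
not a discharge of anything weaker than its conclusion. [cite: Ruzmaikina2008NSVorticityBounds, Proof of Theorem 3 p.22–23] -/
theorem claimed_of_kuLocal (h : KuLocal) : ClaimedTheorem := by
  obtain ⟨C, hC, hL⟩ := h
  intro ν hν u₀ hu₀ T hT
  refine ⟨exists_isSolution_of_localStep hC hν (hL ν hν) hu₀ hT, ?_⟩
  intro u p u' p' hu hu' t ht
  exact (IsClassicalNSSolutionOn.eq_of_hasBoundedSobolevNormsOn hu.sol.isClassical hu'.sol.isClassical hν.le hT
    hu.sol.sobolev hu'.sol.sobolev (hu.initial.trans hu'.initial.symm) ht).symm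

/-- Hence **`KuLocal` implies Clay (A)** (`clay_of_claimed`). [cite: FeffermanClay2006, statement (A)] -/
theorem clay_of_kuLocal (h : KuLocal) : ClayVariants.clayR3.Regularity :=
  clay_of_claimed (claimed_of_kuLocal h)

end Literature.Claims.NS.Ruzmaikina2008

end

-- WHAT THIS IS NOT: not a claim about NS regularity or blow-up; not a claim about any author beyond the
-- typed locator.
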